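import Summits.CriticalPhenomena.SAWScalingLimit.Theses.SAWParafermion
import Summits.CriticalPhenomena.SAWScalingLimit.Theses.SAWRenewalTightness
import Summits.CriticalPhenomena.SAWScalingLimit.Theorems.SubseqIdentification.Negative.EndpointLoadBearing
import Summits.CriticalPhenomena.SAWScalingLimit.Theorems.SubseqIdentification.Negative.Necessity
import Summits.CriticalPhenomena.SAWScalingLimit.Theorems.SubseqIdentification.Negative.ProbabilityRedundant
import Summits.CriticalPhenomena.SAWScalingLimit.Theorems.SAWRenewalTightnessSubseqIdentificationReferenceWindow
import Summits.CriticalPhenomena.SAWScalingLimit.Theorems.SAWRenewalTightnessSubseqIdentificationAreaLawOfLimit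
import Summits.CriticalPhenomena.SAWScalingLimit.Theorems.SAWRenewalTightnessSubseqIdentificationKappaPinHalfPlane
import Summits.CriticalPhenomena.SAWScalingLimit.Theorems.SAWRenewalTightnessSubseqIdentificationWindowTransport
import Summits.CriticalPhenomena.SAWScalingLimit.Theorems.SAWRenewalTightnessSubseqIdentificationKappaPinGlue
import Summits.CriticalPhenomena.SAWScalingLimit.Theorems.SAWRenewalTightnessSubseqIdentificationBoundaryAreaLawReduction
import Summits.CriticalPhenomena.SAWScalingLimit.Theorems.SAWRenewalTightnessSubseqIdentificationSleHalfPlaneAreaLaw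
import Summits.CriticalPhenomena.SAWScalingLimit.Theorems.SAWRenewalTightnessSubseqIdentificationSleAreaLawGlue
import Summits.CriticalPhenomena.SAWScalingLimit.Theorems.SAWRenewalTightnessSubseqIdentificationLatticeAreaLawOfLimitLaw
import Summits.CriticalPhenomena.SAWScalingLimit.Theorems.SAWRenewalTightnessSubseqIdentificationLatticeAreaLawNecessityGlue
import Summits.CriticalPhenomena.SAWScalingLimit.Theorems.SAWRenewalTightnessSubseqIdentificationDockOfCrux
import Summits.CriticalPhenomena.SAWScalingLimit.Theorems.EventualTight.Negative.TightnessNecessary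
import Summits.CriticalPhenomena.SAWScalingLimit.Theorems.SAWRenewalTightnessSubseqIdentificationHalfBallSubdomain
import Summits.CriticalPhenomena.SAWScalingLimit.Theorems.SAWRenewalTightnessSubseqIdentificationHalfBallNesting
import Summits.CriticalPhenomena.SAWScalingLimit.Theorems.SAWRenewalTightnessSubseqIdentificationAreaUpperOfLimit
import Summits.CriticalPhenomena.SAWScalingLimit.Theorems.SAWRenewalTightnessSubseqIdentificationKappaLeOfUpper
import Summits.CriticalPhenomena.SAWScalingLimit.Theorems.SAWRenewalTightnessSubseqIdentificationRestrictionPassage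
import Summits.CriticalPhenomena.SAWScalingLimit.Theorems.SAWRenewalTightnessSubseqIdentificationSleRestrictionConsistency
import Summits.CriticalPhenomena.SAWScalingLimit.Theorems.SAWRenewalTightnessSubseqIdentificationSleAvoidancePositive
import Summits.CriticalPhenomena.SAWScalingLimit.Theorems.SAWRenewalTightnessSubseqIdentificationSleRestrictionTransport
import Literature.Probability.RandomPlanarGeometry.SLEBubblesThm65Kappa
import Summits.CriticalPhenomena.SAWScalingLimit.Theorems.SAWRenewalTightnessSubseqIdentificationSleAvoidProduct
import Summits.CriticalPhenomena.SAWScalingLimit.Theorems.SAWRenewalTightnessSubseqIdentificationThm65TiltedAssembly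
import Summits.CriticalPhenomena.SAWScalingLimit.Theorems.SAWRenewalTightnessSubseqIdentificationCompensatorReduction
import Summits.CriticalPhenomena.SAWScalingLimit.Theorems.SAWRenewalTightnessSubseqIdentificationTiltedMartingalesAssembly
import Summits.CriticalPhenomena.SAWScalingLimit.Theorems.SAWRenewalTightnessSubseqIdentificationTiltedProductMartingale
import Summits.CriticalPhenomena.SAWScalingLimit.Theorems.SAWRenewalTightnessSubseqIdentificationTiltedBracketMartingale
import Summits.CriticalPhenomena.SAWScalingLimit.Theorems.SAWRenewalTightnessSubseqIdentificationRigidityOfLawParts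
import Summits.CriticalPhenomena.SAWScalingLimit.Theorems.SAWRenewalTightnessSubseqIdentificationRigidityOfLawPartsAvoid
import Summits.CriticalPhenomena.SAWScalingLimit.Theorems.SAWRenewalTightnessSubseqIdentificationTiltedLawIdentity
import Summits.CriticalPhenomena.SAWScalingLimit.Theorems.SAWRenewalTightnessSubseqIdentificationCompensatorFactorsAvoidance
import Literature.Probability.RandomPlanarGeometry.RestrictionHullsProofs
import Summits.CriticalPhenomena.SAWScalingLimit.Theorems.SAWRenewalTightnessSubseqIdentificationSteeringVertical
import Summits.CriticalPhenomena.SAWScalingLimit.Theorems.SAWRenewalTightnessSubseqIdentificationSteeringArc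
import Summits.CriticalPhenomena.SAWScalingLimit.Theorems.SAWRenewalTightnessSubseqIdentificationCompensatorTube
import Summits.CriticalPhenomena.SAWScalingLimit.Theorems.SAWRenewalTightnessSubseqIdentificationEssUnboundedOfTube
import Summits.CriticalPhenomena.SAWScalingLimit.Theorems.SAWRenewalTightnessSubseqIdentificationCompensatorEssUnbounded
import Summits.CriticalPhenomena.SAWScalingLimit.Theorems.SAWRenewalTightnessSubseqIdentificationSleRestrictionRigidityBelow

/-!
# Line `boundary-area-law` for crux `SubseqIdentification` (stmt-CriticalPhenomena-0783; primary decl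
# `SAWParafermion.SubseqIdentification`, identical shared decl `SAWRenewalTightness.SubseqIdentification`)

Planner skeleton — crux-plan GENERATION 2 (round 1; idea `Ideas/boundary-area-law.md`, ideator 2; triage
r1-1 fail "κ-pin idle where it docks", r1-2 pass with four sharpenings, r1-3 fail "partial transfer /
standalone"; generation-1 skeleton `sha 268a003d` by planner-cruxplan-…-boundary-area-law-0, re-audited and
RESHAPED here against the disprover's CYCLE-2 `Disproof.lean` (landed 2026-08-16T02:27:54Z, which
generation 1 had not read). Namespace `…Cruxes.SubseqIdentification.BoundaryAreaLaw`; every stub is stated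
over TREE VOCABULARY ONLY (`SAW.law`, `SAW.IsEndpointApprox`, `SAW.DomainSAW.curve`, `CurveClass.range`,
`IsSLELaw`, `DobrushinDomain`, `Metric.infDist`), so each lands verbatim as a `Theorems/…` file
(`--supports stmt-CriticalPhenomena-0783`) without importing this workfile.

THE CRUX (fixed, the route's decl): every subsequential weak limit `μ` (along `s → 0⁺`) of the critical
`δℤ²` SAW laws of a Dobrushin domain `(D; a, b)` with endpoint approximation `(a_δ, b_δ)` is the chordal
SLE_{8/3} law of `(D; a, b)`.

THE LINE. The idea's lever is an AREA LAW for boundary touches: at a flat lattice wall the critical SAW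
comes within `r` of a wall point `x₀ ∉ {a, b}` with probability `≍ r²`, two-sidedly, with ONE pair of
constants for all `0 < r ≤ ε₀` as `δ → 0⁺` (mechanism: exact peeling/restriction identity of `SAW.law`
+ layer-summed bump comparability + boundary rarity, which in fact gives the law at FIXED mesh for all
mesoscopic `2δ ≤ r ≤ ε₀`, see `latticeAreaLaw_of_fixedMesh`); among chordal SLE_κ laws the
boundary-approach exponent is `8/κ − 1` (Alberts–Kozdron), `= 2` iff `κ = 8/3`. As all three triagers
note, an exponent pins `κ` only AFTER something has put the limit inside the SLE_κ family: that input is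
the DOCK (S1, "identification up to κ, one κ per mesh sequence" — the Schramm-principle output of any
conformal-covariance-first line; it is the crux-hard CONFORMAL half and is IMPORTED, exactly as the idea
card's `Transfer:` says). The skeleton is arranged so that (i) the dock is ONE named stub in the weakest
form that ties `κ` across domains, (ii) the area law is needed in ONE REFERENCE DOMAIN ONLY — a lattice
square, where "flat wall" is literal and axis-parallel (a general Jordan `D` has no flat boundary point;
no hull-subdomain surgery, no restriction passage, no simplicity, no `IsEndpointApprox` transfer), (iii)
the SLE side is a pure, known boundary-exponent statement, and (iv) the existence of a subsequential
limit in the reference square — which is TIGHTNESS, the route's own target T′ — enters BY NAME as the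
registered item `SAWRenewalTightness.EventualTight` (stmt-CriticalPhenomena-1372), the Prokhorov step being
PROVED in this file (`subseqLimitsExist_of_eventualTight`, sorry-free).

  S2 reference square `(D₀; a₀, b₀)`, flat window at `x₀`     T′ ⟹ a subsequential limit `μ₀` in `D₀` along `s∘φ`
  S1 dock along `s∘φ`: ONE `κ > 0` with `μ = SLE_κ(D)` AND `μ₀ = SLE_κ(D₀)`
  S4 lattice area law in `D₀` at `x₀`  ⟹(S5, portmanteau)  `c r² ≤ μ₀(dist ≤ r)`, `μ₀(dist < r) ≤ C r²`
  S6 Alberts–Kozdron / Rohde–Schramm pin in `D₀`: `κ = 8/3`   ⟹  `μ = SLE_{8/3}(D)` = the crux BY NAME.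

STUBS (5): S1 `stub_identificationUpToKappa` (DOCK, imported, crux-hard, XXL) · S2 `stub_referenceWindow`
(M, provable now) · S4 `stub_latticeAreaLaw` (THE LINE'S CONTENT; open, XL; HARDEST line-owned stub) ·
S5 `stub_areaLawOfLimit` (M, provable now) · S6 `stub_kappaPin` (L, known SLE: AK08 two-sided boundary
exponent for κ < 8, upper half PROVED in tree; RS05 space-filling for κ ≥ 8 PROVED in tree). Named input:
`EventualTight` (T′, stmt-CriticalPhenomena-1372). `SubseqIdentification_of` composes S1, S2, the T′-consequence, S4,
S5, S6 (kernel-checked, no `sorry`); `SubseqIdentification_proof (hT : EventualTight)` instantiates it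
with the registered stubs; `SubseqIdentification_renewalTightness` transfers it to the identical decl of
the payload route.

GENERATION-2 CHANGES (vs `sha 268a003d`), each forced by an input:
* S4 WEAKENED to the pointwise-in-`r` eventual form (`∃ C ε₀ ∀ r ∈ (0, ε₀] ∀ᶠ δ`): generation 1 registered
  the fixed-mesh form "∀ᶠ δ, ∀ 2δ ≤ r ≤ r' ≤ ε₀", but its own composition (S5) consumed it only at fixed
  radii; the registered obligation is now exactly what the line uses, it is implied by the LSW conjecture
  (continuity of `r ↦ P^{SLE(8/3)}[dist ≤ r]`, restriction formula), hence consistent with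
  `Negative.subseqIdentification_of_sawScalingLimit`, and provers are not forced into lattice-local
  casework at `r ∼ 2δ`. The fixed-mesh law remains the MECHANISM's natural output and implies the stub
  (`latticeAreaLaw_of_fixedMesh`, sorry-free); the idea's cheapest falsifier (exact enumeration of
  `P_δ(k-block)/[k² p_δ]`, `k = 1,2,3`) still tests the mechanism.
* S3 of generation 1 ("subsequential limits exist", an OPEN stub equal in strength to T′) is REPLACED by
  the registered item `EventualTight` taken BY NAME plus the proved Prokhorov extraction — Disproof cycle 2
  §6 proves `SAWScalingLimit ↔ EventualTight ∧ SubseqIdentification` (tightness is NECESSARY), and §7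
  `debt_exists_subseqLimit` is precisely the existential shadow of what the reference square needs; a
  separate tightness stub would have double-staffed the route's rank-0 target.
* Docstrings cite cycle-2 items 8–12 where they bear (S4: item 11 lattice constants, item 12 wall edges in
  `∂Ω`; S1: item 9, the restriction κ-pin competitor; reversibility debt item 8 is a COROLLARY of the crux
  and constrains no stub).

DISPROOF USED (`Cruxes/SubseqIdentification/Disproof.lean`, cdisprove cycles 1–2, NO KILL; and the LANDED
`Theorems/SubseqIdentification/Negative/{EndpointLoadBearing, Necessity, ProbabilityRedundant}.lean`,
imported above so this file is checked against them):
* `subseqIdentification_false_without_endpointLimits / _fstLimit / _sndLimit` — HONOURED: the dock S1 and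
  the limit stub S5 keep `SAW.IsEndpointApprox` / the convergence hypotheses verbatim (an `IsSLELaw κ D μ`
  conclusion without the endpoint limits is refuted by the Dirac witness
  `Negative.not_isSLELaw_dirac_of_endpoint_ne` for EVERY κ — the stub that uses H = endpoint limits is S1);
  S2/S4 use `IsEndpointApprox D₀ a₀ b₀` of the reference square (Disproof §0b `stdA/stdB` pattern).
* `…_false_without_oneSided / _meshToZero` — HONOURED: every lattice clause is along `𝓝[>] 0`
  (S4 `∀ᶠ δ in 𝓝[>] 0`; S1/S5 `Tendsto s atTop (𝓝[>] 0)`).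
* `subseqIdentification_iff_withoutProb` (§1c) — `IsProbabilityMeasure μ` kept (harmless, derivable); its
  lemma `Negative.eventually_isProbabilityMeasure_law` is USED here (Prokhorov past the junk meshes).
* `Negative.subseqIdentification_of_sawScalingLimit` (necessity, §3/§6) — consistent: S1, S5, S6 and the
  weakened S4 are implied by (or independent of) `SAWScalingLimit`; T′ is implied by it (§6
  `eventualTight_of_sawScalingLimit`). No stub is beyond the conjecture any more.
* §5 reversibility debt (`isSLELaw_swap_of_subseqIdentification`, `debt_sle_eightThirds_reversible`): a
  corollary of the crux, not an input; nothing in this line breaks lattice reversal symmetry (S4's event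
  `{dist(x₀, trace) ≤ r}` is reversal-invariant, `map_sawReverse_law`).
* §8 item 9 (κ-rigidity via exact lattice restriction + LSW03): the COMPETITOR pin inside the same dock —
  recorded in the line card with the exact comparison (it needs the `meshDomain` nesting caveat of item 9,
  continuity of `{γ ∩ A = ∅}` under the identified SLE_κ, the LSW03 converse, and a lattice LOWER bound on
  `P_δ[γ avoids A]` to exclude κ ≥ 8; this line needs S4 instead and handles every κ > 0 in S6).
Negatives index (9 items, 2026-08-16): stmt-0772 (all-δ `Tight`) is avoided — T′ is the repaired (∃ δ₀)
form; stmt-5420 / stmt-8312 / stmt-8261 do not bear (no observable, no fugacity deformation; S4's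
constants are `∃` after `(D, a, b, x₀)` and the window radius is macroscopic).

LEAD c3, CYCLE 1 (2026-08-16/17) — THE NECESSITY PACKAGE (all landed; `Theorems/SAWRenewalTightnessSubseqIdentification
{SleHalfPlaneAreaLaw p130321, SleAreaLawGlue p130316, LatticeAreaLawOfLimitLaw p130421, LatticeAreaLawNecessityGlue p130318,
DockOfCrux p130304, Necessity}.lean`, stubs registered by `stub-add`): the reduction of this line is EXACT modulo T′ —
`subseqIdentification_iff_stubs (hT : EventualTight) : SubseqIdentification ↔ S1 ∧ S4` and, at the summit level,
`sawScalingLimit_iff_stubs : SAW.SAWScalingLimit ↔ EventualTight ∧ S1 ∧ S4` (below, by name from the landed assembly). So BOTH residual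
stubs are necessary (each follows from `SAWScalingLimit`; a refutation of either refutes the LSW conjecture as typed) and jointly
sufficient; the SLE-side consistency half of S6 (`κ = 8/3 ⇒ two-sided r² law at a flat window`, `sleAreaLawAtWindow`) is in the tree.
ONE WINDOW SUFFICES (`Theorems/SAWRenewalTightnessSubseqIdentificationWindowReduction.lean`, p130802): the composition consumes
the lattice inputs in the reference square ONLY, so `SubseqIdentification_of_dock_of_window : S1 → W → crux` with W = ∃ ONE Dobrushin
domain carrying an endpoint approximation, a flat window, tightness ALONG THE MESH of its pushed SAW laws and the lattice area law there
(no global `EventualTight`); `window_of_sawScalingLimit : SAWScalingLimit → W`; `SAWScalingLimit ↔ EventualTight ∧ S1 ∧ W`.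

LEAD c4, CYCLE 1 (2026-08-16/17) — THE RESTRICTION RESHAPE OF THE κ-PIN (section "Restriction reshape" at the end of this file;
stubs registered by `stub-add`): S4 is split; its LOWER half (which only serves `κ ≥ 8/3`) is replaced by the LSW restriction pin —
exact lattice restriction (`SAW.law_setOf_exists_support_eq_eq`) + RS2a `stub_halfBallSubdomain` (carved Dobrushin domain
`D ∖ B̄(x₀, r)` at the flat window) + RS2b `stub_halfBallNesting` (lattice nesting, endpoint transfer, sandwich of the confinement
event) + RS3 `stub_restrictionPassage` (portmanteau passage of the restriction identity to subsequential limits at every radius that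
is not an atom of `dist(x₀, trace)` under the limit — NO SLE input) + RS5 `stub_sleRestrictionRigidity` (LSW03 Prop. 5.3/Thm. 6.5:
among SLE_κ, κ ≤ 4, only κ = 8/3 satisfies the identity — the SLE-side debt, closed mathematics); its UPPER half is kept as S4⁺
`stub_latticeAreaUpperBound` with one-sided consumers S5⁺ `stub_areaUpperOfLimit`, S6⁺ `stub_kappaLeOfUpper` (provable now from the
landed p96448/p96666/p96955/p96964). `SubseqIdentification_of_restriction` composes S1, S2, T′, S4⁺, S5⁺, S6⁺, RS2a, RS2b, RS3, RS5
(sorry-free over its hypotheses); `SubseqIdentification_proof_restriction (hT : EventualTight)` instantiates it. Residual of the line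
after the reshape: S1 ∧ S4⁺ ∧ T′ ∧ RS5 (the only OPEN lattice inputs are the dock and a ONE-SIDED rarity bound).

LEAD c5, CYCLE 1 (2026-08-17) — L3 CLOSED BY SEMICIRCLE STEERING; THE SLE SIDE OF THE LINE IS COMPLETE (section "L3 RESHAPED" below;
stubs registered by `stub-add`): c4's residual SLE debt L3 `stub_compensatorEssUnbounded` (essential unboundedness of the LSW compensator
on the avoidance event, for EVERY nonempty `A ∈ 𝒬*`) is proved by the support route with NO potential theory: aim at `A` along the
semicircle from `0` orthogonal to `ℝ` through a point of `A ∩ ℍ` (Möbius image of the zero-driver chain, `LoewnerMoebiusImageChain`;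
vertical ray when `A` meets `iℝ₊`) — L3a-V `stub_steeringVertical` p157732, L3a-A `stub_steeringArc` p158795; transfer to every driver
in a sup-norm tube by Kemppainen–Smirnov stability + the pointwise mass bound — L3b `stub_compensatorTube` p157904; tube positivity +
simple Markov property (freezing at `S`, `BrownianPathFreezing`) + the point cocycle (real points included, p159573) + [LSW] Thm. 6.5
positivity — L3c `stub_compensatorEssUnbounded_of_tube` p160197; L3 glue p160397; hence RS5 `stub_sleRestrictionRigidityBelow`
(restriction rigidity of SLE_κ below 8/3, UNCONDITIONAL) p160681. Residual of the line: S1 (dock) ∧ S4⁺ (one-sided lattice rarity bound) ∧ T′;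
the composition with every other input discharged is landed as `Theorems/…RestrictionAssembly.lean`
(`SubseqIdentification_of_dock_of_upperBound : S1 → S4⁺ → EventualTight → crux`).

-/

open MeasureTheory Filter Topology Set
open scoped NNReal ENNReal BoundedContinuousFunction

namespace Summit.CriticalPhenomena.SAWScalingLimit.Cruxes.SubseqIdentification.BoundaryAreaLaw

open Literature.Probability.RandomPlanarGeometry Literature.Probability.LatticeModels
open Literature.Probability.Process (preWienerMeasure)
open UpperHalfPlane (upperHalfPlaneSet)
open Summit.CriticalPhenomena.SAWScalingLimit.Theses.SAWParafermion (SubseqIdentification)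
open Summit.CriticalPhenomena.SAWScalingLimit.Theses.SAWRenewalTightness (EventualTight)

/-! ## The stubs -/

/-- **S1 — THE DOCK: identification up to `κ` (IMPORTED input of the consuming line; crux-hard, open).**
For every mesh sequence `s → 0⁺` there is ONE `κ > 0` such that, for every Dobrushin domain `(D; a, b)`,
every endpoint approximation and every probability measure `μ` that is the weak limit along `s` of the
pushed critical SAW laws, `μ` is the chordal SLE_κ law of `(D; a, b)`.
This is the normal form of the output of Schramm's principle (conformal covariance + domain Markov of the
family of subsequential limits ⇒ SLE_κ for one undetermined κ; Schramm2000 §1, LawlerSchrammWerner2004SAW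
§4.1) — the penultimate step of every convergence-to-SLE proof, where `κ` is then read off an exponent or
an observable (LERW: a martingale; percolation: Cardy; here: the boundary area law). It is the CONFORMAL
half of the crux and is where the square symmetry of `ℤ²` must be spent (Disproof §4.7,
`Literature.Barriers.CriticalPhenomena.EmbeddingModulusUniqueness`); this line does not supply it (idea
card `Transfer:`; triage r1-1/r1-3), its suppliers are the cone's CI-first routes (SAWConfRestriction.ConfCovLimit
stmt-CriticalPhenomena-0771, SAWRestrictionRigidity / ZoomRigidity / IsotropicAnchor, with KS describability
`SAWParafermion.KSConditionG2` stmt-CriticalPhenomena-0792 as their first input). It is strictly weaker than the crux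
(take κ = 8/3, `identificationUpToKappa_of_crux`), hence true if the LSW conjecture is; it keeps
`IsEndpointApprox` and `𝓝[>] 0` verbatim, honouring
`subseqIdentification_false_without_endpointLimits/_fstLimit/_sndLimit/_oneSided/_meshToZero` (the Dirac
witness `Negative.not_isSLELaw_dirac_of_endpoint_ne` refutes the endpoint-free version for every κ).
Per-sequence (not per-domain) κ is the weakest form that ties the reference square of S2 to `D`; with a
per-(D, μ) κ the transfer would need germ rigidity / restriction descent. COMPETITOR inside the same dock
(triage r1-1 §D3(b) = Disproof cycle 2 §8 item 9): exact lattice restriction + continuity of `{γ ∩ A = ∅}`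
under the identified SLE_κ + the LSW03 converse pin κ = 8/3 among κ < 8 without S4, but need a lattice
lower bound on `P_δ[γ avoids A]` (open, RSW-type) to exclude κ ≥ 8 and the `meshDomain` nesting caveat;
the lead costs the two pins against each other (line card). Size: XXL/open. -/
theorem stub_identificationUpToKappa :
    ∀ (s : ℕ → ℝ), Tendsto s atTop (𝓝[>] (0 : ℝ)) →
      ∃ κ : ℝ≥0, 0 < κ ∧
        ∀ (D : DobrushinDomain) (a b : ℝ → Site 2), SAW.IsEndpointApprox D a b →
          ∀ (μ : Measure (CurveClass ℂ)), IsProbabilityMeasure μ →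
            (∀ f : CurveClass ℂ →ᵇ ℝ,
              Tendsto (fun n => ∫ γ, f γ.curve ∂(SAW.law D.carrier (s n) (a (s n)) (b (s n))))
                atTop (𝓝 (∫ x, f x ∂μ))) →
            IsSLELaw κ D μ := by
  sorry

/-- **S2 — A REFERENCE DOBRUSHIN DOMAIN WITH A FLAT LATTICE WALL (provable now, M).**
There are a Dobrushin domain `D₀`, an endpoint approximation `(a₀, b₀)` of it (`SAW.IsEndpointApprox`),
a point `x₀` and a radius `ρ₀ > 0` such that `D₀ ∩ B(x₀, ρ₀)` is the open upper half-disc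
`{Im z > Im x₀} ∩ B(x₀, ρ₀)` — a straight HORIZONTAL (axis-parallel) wall through `x₀` — and `x₀` is
neither marked point. Intended witness: the open square `(-1,1)²` (tree: `rectDomain 1 1 one_pos one_pos`
of `RectangleConformalMap.lean`, carrier `symRect 1 1`, `frontier_symRect`; marks at the loop parameters of
`(1,0)` and `(-1,0)`), `a₀ δ = ![⌈δ⁻¹⌉ - 1, 0]`, `b₀ δ = -a₀ δ` (the `stdA/stdB` pattern of
`Negative.CoincidentEndpointLaw`: mesh points `→ ±1`, `dist ≤ δ`, joined along the row `y = 0` inside the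
square; the square's mesh-vertex graph is a grid box, hence connected, so `meshDomain = meshVertices`),
`x₀ = -I` (bottom mid-point), `ρ₀ = 1/2`. Any other polygon with an axis-parallel side works. Why a separate
stub: it is the only place where a CONCRETE domain is built, and it fixes the axis-parallel wall the lattice
mechanism of S4 peels along (triage r1-2 sharpen (1)(3): bumps, not bays; constants for a fixed domain). -/
theorem stub_referenceWindow :
    ∃ (D₀ : DobrushinDomain) (a₀ b₀ : ℝ → Site 2) (x₀ : ℂ) (ρ₀ : ℝ),
      SAW.IsEndpointApprox D₀ a₀ b₀ ∧ 0 < ρ₀ ∧ x₀ ≠ D₀.pt 0 ∧ x₀ ≠ D₀.pt 1 ∧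
        D₀.carrier ∩ Metric.ball x₀ ρ₀ = {z : ℂ | x₀.im < z.im} ∩ Metric.ball x₀ ρ₀ :=
  _root_.Summit.CriticalPhenomena.SAWScalingLimit.Theorems.SubseqIdentification.BoundaryAreaLaw.stub_referenceWindow

/-- **S4 — THE LATTICE BOUNDARY AREA LAW (the line's content; OPEN, XL; hardest line-owned stub).**
For a Dobrushin domain `(D; a, b)` with endpoint approximation `(a_δ, b_δ)` and a flat horizontal window
`D ∩ B(x₀, ρ₀) = {Im z > Im x₀} ∩ B(x₀, ρ₀)` at a wall point `x₀ ∉ {a, b}`, there are `C > 0`, `ε₀ > 0`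
such that for EVERY radius `0 < r ≤ ε₀`, for all small meshes `δ` (depending on `r`), the probabilities
`P_δ(r) := P_δ[dist(x₀, trace) ≤ r]` (critical SAW law of `Ω_δ` from `a_δ` to `b_δ`, trace = the polyline
`SAW.DomainSAW.curve`, `CurveClass.range`) satisfy the two-sided AREA LAW against the reference radius `ε₀`:
`C⁻¹ (r/ε₀)² P_δ(ε₀) ≤ P_δ(r) ≤ C (r/ε₀)² P_δ(ε₀)` (written cross-multiplied in `ℝ≥0∞`; equivalent up to
`C ↦ C²` to the two-radius form `P_δ(r)/P_δ(r') ≍ (r/r')²`; self-normalising: the unknown boundary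
one-point function `p_δ(x₀)` cancels — triage r1-1). THIS is the registered obligation: pointwise in `r`,
eventual in `δ`, one pair of constants for all `r` — exactly what S5 consumes; it is implied by the LSW
conjecture (SLE_{8/3} at an analytic boundary point: `P[dist ≤ r] = 1 − (Φ'_r(a)Φ'_r(b))^{5/8} ≍ r²`,
continuous in `r`, so `{dist ≤ r}` is a continuity set). MECHANISM (idea card, sharpened by triage; it
proves MORE, namely the fixed-mesh law `latticeAreaLaw_of_fixedMesh` for all `2δ ≤ r ≤ r' ≤ ε₀`):
(P1) EXACT PEELING IDENTITY — removing lattice sites from the domain conditions `SAW.law` on avoiding them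
(restriction-exactness of the `x_c^{|γ|}` weights; the sub-domain's graph is a subgraph), so
`P_δ[avoid A] = ∏ᵢ (1 - p_{Dᵢ}(ζᵢ))` along any site-by-site peeling and
`|log P_δ[avoid A] + Σ p_{Dᵢ}(ζᵢ)| ≤ Σ pᵢ²/(1 - max pᵢ)`; peel the lattice half-ball of radius `r` at `x₀`
ROW BY ROW, so every intermediate domain is the flat wall with a rectangular BUMP (two reflex corners on
top, two convex wall junctions — r1-2 sharpen (1)); (K1) LAYER-SUMMED BUMP COMPARABILITY — the sum over a
bump layer of the visit probabilities is within constant factors of (layer length) × (flat-wall visit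
probability nearby); only layer sums are used, because sitewise comparability is false at the corners
(reflex corner enhancement `≍ (j/m)^{2/3}`, junction suppression `≍ (m/j)²`, both integrable along the
layer — r1-1 §D3(d), r1-2 (2), r1-3); (K2) BOUNDARY RARITY / translation comparability along the wall —
`P_δ[dist ≤ ε₀] ≤ 1 - c` and `p_δ(x) ≍ p_δ(x')` for wall sites `x, x'` near `x₀` (linearisation input).
Then `P_δ(r) ≍ (r/δ)² p_δ(x₀)`, whence the ratio law. LATTICE GEOMETRY AT THE WALL (checked against
`DomainDiscretisation.lean` and Disproof cycle 2 §8): mesh vertices lie in the OPEN carrier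
(`meshVertices Ω δ = {x | δx ∈ Ω}`), so inside the window `Ω_δ` is the discrete half-plane
`{Im > Im x₀} ∩ δℤ²` with its first row at height `∈ (0, δ]` above the wall (varying with `δ`; absorbed by
the constants, which is one more reason the registered form is eventual in `δ` per radius); item 12
(edges running inside `∂Ω`) cannot occur inside the window, since both endpoints of an edge lie strictly
above the wall; item 11 — Kennedy–Lawler lattice effects (angle-dependent boundary densities) live in the
constants `C`, never in the exponent. Why it might fail: K1/K2 are RSW-type
up-to-constants estimates for `x_c`-SAW on `ℤ²`, of the class no one can prove yet (no FKG, no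
observable; KemppainenSmirnov2017 §4 omits SAW; DuminilCopinHammond2013 is the strongest surgery result) —
the technology that would feed them is this route's own TubeLowerBound (stmt-CriticalPhenomena-4730) / AnnularMassDecay
(stmt-CriticalPhenomena-4729) surgery. Constants depend on `(D, a, b, x₀)` (∃ after ∀ — r1-2 sharpen (3): "uniform in
D" is false, hairline-corridor witness); no non-degeneracy is needed in the ratio form (both sides vanish
together — r1-2 (4)). Affine-invariant (holds verbatim on `diag(1,p)ℤ²`), so it pins nothing without S1
(declared; `EmbeddingModulusUniqueness` untouched). Cheapest falsifier of the MECHANISM: exact enumeration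
in `W×H` boxes (kit j008970 data of the ideator) of `P_δ[SAW hits a k-block of the wall]/[k² p_δ(centre)]`,
`k = 1,2,3`, and of bump-layer visit sums after digging `j ≤ k` rows (must stay within constant factors).
Sources: idea card; FriedrichWerner2003 ("boundary exponent 2"), LawlerSchrammWerner2003Restriction Thm 6.1,
KennedyLawler2013, AlbertsKozdron2007 Thm 1.1. -/
theorem stub_latticeAreaLaw :
    ∀ (D : DobrushinDomain) (a b : ℝ → Site 2), SAW.IsEndpointApprox D a b →
      ∀ (x₀ : ℂ) (ρ₀ : ℝ), 0 < ρ₀ →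
        D.carrier ∩ Metric.ball x₀ ρ₀ = {z : ℂ | x₀.im < z.im} ∩ Metric.ball x₀ ρ₀ →
        x₀ ≠ D.pt 0 → x₀ ≠ D.pt 1 →
        ∃ C ε₀ : ℝ, 0 < C ∧ 0 < ε₀ ∧ ∀ r : ℝ, 0 < r → r ≤ ε₀ →
          ∀ᶠ δ in 𝓝[>] (0 : ℝ),
            SAW.law D.carrier δ (a δ) (b δ) {γ | Metric.infDist x₀ γ.curve.range ≤ r} *
                ENNReal.ofReal (ε₀ ^ 2) ≤
              ENNReal.ofReal C *
                SAW.law D.carrier δ (a δ) (b δ) {γ | Metric.infDist x₀ γ.curve.range ≤ ε₀} *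
                  ENNReal.ofReal (r ^ 2) ∧
            SAW.law D.carrier δ (a δ) (b δ) {γ | Metric.infDist x₀ γ.curve.range ≤ ε₀} *
                ENNReal.ofReal (r ^ 2) ≤
              ENNReal.ofReal C *
                SAW.law D.carrier δ (a δ) (b δ) {γ | Metric.infDist x₀ γ.curve.range ≤ r} *
                  ENNReal.ofReal (ε₀ ^ 2) := by
  sorry

/-- **S5 — AREA LAW OF THE LIMIT (limit passage; provable now, M).**
If the pushed SAW laws converge weakly to a probability measure `μ` along `s → 0⁺`, the lattice ratio law of
S4 holds along the sequence (cross-multiplied against the reference radius `ε₀`, for every fixed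
`0 < r ≤ ε₀` eventually in `n`), and `μ` is non-degenerate at `x₀` (`μ[dist(x₀, trace) < ε] > 0` for every
`ε > 0`), then `μ` satisfies the CONTINUUM two-sided area law `c r² ≤ μ[dist ≤ r]`, `μ[dist < r] ≤ C' r²`
for `0 < r < r₀`. Proof route (portmanteau on the Polish `CurveClass ℂ`; the laws are probability measures
eventually, `Negative.eventually_isProbabilityMeasure_of_tendsto` from the `f ≡ 1` test integral, and have
mass ≤ 1 always, `Negative.isProbabilityMeasure_law_or_eq_zero`): `c ↦ infDist x₀ c.range` is 1-Lipschitz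
on `CurveClass ℂ` (`Curve.infDist_range_le`, pattern of `CurveClass.lipschitzWith_source`), so `{dist ≤ r}` is closed and
`{dist < r}` open, and the convergence hypothesis is weak convergence of the image measures
(`integral_map`, `ProbabilityMeasure.tendsto_iff_forall_integral_tendsto`). Take `r₀ = ε₀`. Upper:
`μ(< r) ≤ liminf P_n(< r) ≤ liminf P_n(≤ r) ≤ C (r/ε₀)² · 1`
(`ProbabilityMeasure.le_liminf_measure_open_of_tendsto`). Lower: `limsup P_n(≤ r) ≤ μ(≤ r)` (closed,
`ProbabilityMeasure.limsup_measure_closed_le_of_tendsto`) and `P_n(≤ r) ≥ C⁻¹ (r/ε₀)² P_n(≤ ε₀) ≥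
C⁻¹ (r/ε₀)² P_n(< ε₀)` with `liminf P_n(< ε₀) ≥ μ(< ε₀) > 0` (open; non-degeneracy), hence
`μ(≤ r) ≥ c r²` with `c = μ(< ε₀)/(C ε₀²)`. Non-degeneracy is an INPUT here (r1-2 sharpen (4)); S6 (i)
supplies it from the dock. -/
theorem stub_areaLawOfLimit :
    ∀ (D : DobrushinDomain) (a b : ℝ → Site 2) (s : ℕ → ℝ) (μ : Measure (CurveClass ℂ)) (x₀ : ℂ),
      Tendsto s atTop (𝓝[>] (0 : ℝ)) → IsProbabilityMeasure μ →
      (∀ f : CurveClass ℂ →ᵇ ℝ,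
        Tendsto (fun n => ∫ γ, f γ.curve ∂(SAW.law D.carrier (s n) (a (s n)) (b (s n))))
          atTop (𝓝 (∫ x, f x ∂μ))) →
      (∃ C ε₀ : ℝ, 0 < C ∧ 0 < ε₀ ∧ ∀ r : ℝ, 0 < r → r ≤ ε₀ → ∀ᶠ n in atTop,
          SAW.law D.carrier (s n) (a (s n)) (b (s n)) {γ | Metric.infDist x₀ γ.curve.range ≤ r} *
                ENNReal.ofReal (ε₀ ^ 2) ≤
              ENNReal.ofReal C *
                SAW.law D.carrier (s n) (a (s n)) (b (s n))
                    {γ | Metric.infDist x₀ γ.curve.range ≤ ε₀} *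
                  ENNReal.ofReal (r ^ 2) ∧
            SAW.law D.carrier (s n) (a (s n)) (b (s n)) {γ | Metric.infDist x₀ γ.curve.range ≤ ε₀} *
                ENNReal.ofReal (r ^ 2) ≤
              ENNReal.ofReal C *
                SAW.law D.carrier (s n) (a (s n)) (b (s n))
                    {γ | Metric.infDist x₀ γ.curve.range ≤ r} *
                  ENNReal.ofReal (ε₀ ^ 2)) →
      (∀ ε : ℝ, 0 < ε → 0 < μ {γ | Metric.infDist x₀ γ.range < ε}) →
      ∃ c C r₀ : ℝ, 0 < c ∧ 0 < r₀ ∧ ∀ r ∈ Set.Ioo (0 : ℝ) r₀,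
        ENNReal.ofReal (c * r ^ 2) ≤ μ {γ | Metric.infDist x₀ γ.range ≤ r} ∧
          μ {γ | Metric.infDist x₀ γ.range < r} ≤ ENNReal.ofReal (C * r ^ 2) :=
  _root_.Summit.CriticalPhenomena.SAWScalingLimit.Theorems.SubseqIdentification.BoundaryAreaLaw.stub_areaLawOfLimit

/-- **S6a — THE κ-PIN IN THE HALF-PLANE: two-sided boundary exponent `8/κ − 1` of the SLE_κ trace at a
real point `u₀ ≠ 0` (known SLE theory, every ingredient PROVED in the tree; M/L).**
For `κ > 0` with `HasSLETrace κ` (supplied from `IsSLELaw` by `IsSLELaw.hasSLETrace`) and `u₀ ∈ ℝ ∖ {0}`: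
(i) NON-DEGENERACY `P[dist(u₀, γ[0,∞)) < ρ] > 0` for every `ρ > 0`; (ii) PIN: a two-sided area law
`c ρ² ≤ P[dist ≤ ρ]`, `P[dist < ρ] ≤ C ρ²` for small `ρ` forces `κ = 8/3`. Proof route. `0 < κ < 8`:
UPPER bound `P[dist(u₀, γ) ≤ ρ] ≤ C₁ (ρ/|u₀|)^{8/κ−1}` for `ρ ≤ |u₀|/4` — Alberts–Kozdron Thm 3.2,
PROVED: `measure_infDist_ofReal_sleTrace_le` (`SLEBoundaryProximity.lean`, `x > 0`) and its mirror
`measure_infDist_neg_ofReal_sleTrace_le` (`SLEUnifiedHitting.lean`, `u₀ < 0`; else reflect with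
`SLERealAvoidance`'s `IdentDistrib (sleTrace κ) (−conj ∘ sleTrace κ)`); LOWER bound
`P[dist(u₀, γ) ≤ ρ] ≥ c₁ (ρ/|u₀|)^{8/κ−1}` for small `ρ` from Beffara's interior one-point LOWER estimate,
PROVED: `measure_infDist_sleTrace_le_ge` (`SLEOnePointLowerEstimate.lean`) at `z = u₀ + iρ/2`, `ε = ρ/4`
(`dist(z, γ) ≤ ρ/4 ⇒ dist(u₀, γ) ≤ 3ρ/4`; the angular factor
`rsGhatSlope (1−κ/8) κ (Re z/Im z) = (1 + (2u₀/ρ)²)^{−(4/κ−1/2)} ≥ c (ρ/|u₀|)^{8/κ−1}` for `ρ ≤ |u₀|`,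
`rsGhatSlope_critical` / `SLECriticalGhat.lean`). With the hypothesis: `c ρ² ≤ C₁' ρ^{8/κ−1}` as `ρ → 0`
gives `8/κ − 1 ≤ 2`, and `c₁' ρ^{8/κ−1} ≤ P[≤ ρ] ≤ P[< 2ρ] ≤ 4C ρ²` gives `8/κ − 1 ≥ 2`; so `κ = 8/3`
(`Real.rpow` monotonicity in the exponent for base `< 1`; conclude in `ℝ≥0`). `κ ≥ 8`: the trace is a.s.
space-filling (`ae_isSpaceFilling_sleTrace_of_hasSLETrace_apply`, `IsSpaceFilling`: `u₀ ∈ ℍ̄ = closure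
of the range`, so `infDist = 0`), hence `P[dist < ρ] = 1` for all `ρ`, contradicting `≤ C ρ²` as `ρ → 0`
(`isProbabilityMeasure_preWienerMeasure'`); (i) likewise (lower estimate for `κ < 8`, space-filling for
`κ ≥ 8`). Strict monotonicity of `κ ↦ 8/κ − 1` is what makes the pin sharp. [cite: AlbertsKozdron2007, Thm 1.1]
[cite: Beffara2008, Prop. 4] -/
theorem stub_kappaPinHalfPlane :
    ∀ (κ : ℝ≥0), 0 < κ → HasSLETrace κ → ∀ (u₀ : ℝ), u₀ ≠ 0 →
      (∀ ρ : ℝ, 0 < ρ →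
          0 < preWienerMeasure {ω | Metric.infDist (u₀ : ℂ) (Set.range (sleTrace κ ω)) < ρ}) ∧
        ((∃ c C ρ₀ : ℝ, 0 < c ∧ 0 < ρ₀ ∧ ∀ ρ ∈ Set.Ioo (0 : ℝ) ρ₀,
            ENNReal.ofReal (c * ρ ^ 2) ≤
                preWienerMeasure {ω | Metric.infDist (u₀ : ℂ) (Set.range (sleTrace κ ω)) ≤ ρ} ∧
              preWienerMeasure {ω | Metric.infDist (u₀ : ℂ) (Set.range (sleTrace κ ω)) < ρ} ≤
                ENNReal.ofReal (C * ρ ^ 2)) →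
          κ = 8 / 3) :=
  _root_.Summit.CriticalPhenomena.SAWScalingLimit.Theorems.SubseqIdentification.BoundaryAreaLaw.stub_kappaPinHalfPlane

/-- **S6b — FLAT-WINDOW TRANSPORT (deterministic complex analysis; provable now, L).**
Let `(D; a, b)` be a Dobrushin domain with a flat horizontal window
`D ∩ B(x₀, ρ₀) = {Im z > Im x₀} ∩ B(x₀, ρ₀)` at `x₀ ∉ {a, b}` and let `φ : ℍ → D` be a chordal
uniformizing map (`0 ↦ a`, `∞ ↦ b`), `Φ = φ.boundaryExtension` (continuous on `ℍ̄` by Carathéodory,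
`JordanDomain.continuousOn_boundaryExtension_holds`). Then `x₀ = Φ(u₀)` for ONE real `u₀ ≠ 0`
and `Φ` is two-sidedly Lipschitz AT `u₀` relative to the closed half-plane: there are `L, η > 0`
with `|Φ(u) − x₀| ≤ L |u − u₀|` whenever `Im u ≥ 0`, `|u − u₀| < η`, and `|u − u₀| ≤ L |Φ(u) − x₀|`
whenever `Im u ≥ 0`, `|Φ(u) − x₀| < η`. Proof route: `G := φ⁻¹` on the upper half-ball
`D ∩ B(x₀, ρ₀)` is continuous up to the wall with REAL boundary values (Carathéodory in disc form,
`JordanDomain.exists_continuousOn_extension_holds`: the disc extension is a continuous bijection of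
compacta, hence a homeomorphism, and `b = Φ(∞) ≠ x₀` keeps `G` bounded near `x₀`; real points of
`∂ℍ` go to `∂D`, and `∂D ∩ B(x₀, ρ₀)` is the wall segment by the window identity), so the Schwarz
reflection of `w ↦ G(w + x₀)` across `ℝ` (`Complex.differentiableOn_schwarzReflection`,
`Literature/Analysis/Complex/SchwarzReflection.lean`, `U = B(0, ρ₀)`) is holomorphic and injective on
`B(x₀, ρ₀)` with `G(x₀) = u₀ ∈ ℝ`; `G'(x₀) ≠ 0` (injective holomorphic), so `G` and its local inverse
are Lipschitz near `x₀` / `u₀` (`HasDerivAt` + the inverse function theorem, or reflect `φ` across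
`(u₀ - η, u₀ + η)` symmetrically); `G ∘ Φ = id` on `Φ⁻¹(B(x₀, η)) ∩ ℍ̄` (on `ℍ` by `φ.symm ∘ φ = id`,
on `ℝ` by continuity); `u₀ ≠ 0` because `Φ(0) = a ≠ x₀`
(`MarkedDomain.IsChordalUniformizing`, `ConformalEquiv.boundaryExtension_eq_of_hasBoundaryValue`).
One constant `L` serves both directions. [folklore: Pommerenke (1992) Thm 2.6 + Schwarz reflection] -/
theorem stub_windowTransport :
    ∀ (D : DobrushinDomain) (x₀ : ℂ) (ρ₀ : ℝ), 0 < ρ₀ →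
      D.carrier ∩ Metric.ball x₀ ρ₀ = {z : ℂ | x₀.im < z.im} ∩ Metric.ball x₀ ρ₀ →
      x₀ ≠ D.pt 0 → x₀ ≠ D.pt 1 →
      ∀ (φ : ConformalEquiv upperHalfPlaneSet D.carrier), D.IsChordalUniformizing φ →
        ∃ u₀ L η : ℝ, u₀ ≠ 0 ∧ 0 < L ∧ 0 < η ∧
          ∀ u : ℂ, 0 ≤ u.im →
            (dist u (u₀ : ℂ) < η →
                dist (φ.boundaryExtension u) x₀ ≤ L * dist u (u₀ : ℂ)) ∧
            (dist (φ.boundaryExtension u) x₀ < η →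
                dist u (u₀ : ℂ) ≤ L * dist (φ.boundaryExtension u) x₀) :=
  _root_.Summit.CriticalPhenomena.SAWScalingLimit.Theorems.SubseqIdentification.BoundaryAreaLaw.stub_windowTransport

/-- **S6c — THE GLUE `S6a ∧ S6b ⇒ S6` (measure bookkeeping; provable now, M).**
From the half-plane pin (S6a, hypothesis `hpin`) and the flat-window transport (S6b, hypothesis
`htr`) to the registered κ-pin for SLE laws in `D`: unfold `IsSLELaw κ D μ` to `μ = P.map Γ` with
`Γ ω = CurveClass.mk c_ω`, `c_ω` the time-compactified image of `sleTrace κ ω` under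
`Φ = φ.boundaryExtension` ending at `b = D.pt 1` (`IsSLECurve`, `IsCompactifiedImage`; trace exists by
`IsSLELaw.hasSLETrace`), so that a.s. `(Γ ω).range = Φ '' range (sleTrace κ ω) ∪ {b}`
(`CurveClass.range_mk`, `exists_rayParam_eq`); for `r < dist(x₀, b)` (`x₀ ≠ b`) the events
`{infDist x₀ (Γ ω).range ≤ r}` are therefore sandwiched, up to the null set, between
`{infDist u₀ (range sleTrace) ≤ r/L}` and `{infDist u₀ (range sleTrace) ≤ L r}` by S6b (the trace lies
in `ℍ̄`: `sleTrace` takes values in the closed half-plane — `Loewner.trace`; `infDist` over the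
nonempty compact range is attained / approximated, `Metric.infDist_le_dist_of_mem`,
`Metric.infDist_lt_iff`); `μ S = P (Γ ⁻¹' S)` for the closed/open sets `S = {infDist x₀ ·.range ≤ / < r}`
(`Measure.map_apply_of_aemeasurable`; `c ↦ infDist x₀ c.range` is 1-Lipschitz on `CurveClass ℂ` by
`Curve.infDist_range_le` through `CurveClass.surjective_mk`, pattern of `CurveClass.lipschitzWith_source`),
and `Measure.le_map_apply` suffices for the lower directions. Then (i) and the two-sided `r²` law
transfer to `u₀` with constants `c/L²`, `C L²` (and radii scaled by `L`), and S6a concludes. [folklore] -/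
theorem stub_kappaPinGlue :
    (∀ (κ : ℝ≥0), 0 < κ → HasSLETrace κ → ∀ (u₀ : ℝ), u₀ ≠ 0 →
      (∀ ρ : ℝ, 0 < ρ →
          0 < preWienerMeasure {ω | Metric.infDist (u₀ : ℂ) (Set.range (sleTrace κ ω)) < ρ}) ∧
        ((∃ c C ρ₀ : ℝ, 0 < c ∧ 0 < ρ₀ ∧ ∀ ρ ∈ Set.Ioo (0 : ℝ) ρ₀,
            ENNReal.ofReal (c * ρ ^ 2) ≤
                preWienerMeasure {ω | Metric.infDist (u₀ : ℂ) (Set.range (sleTrace κ ω)) ≤ ρ} ∧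
              preWienerMeasure {ω | Metric.infDist (u₀ : ℂ) (Set.range (sleTrace κ ω)) < ρ} ≤
                ENNReal.ofReal (C * ρ ^ 2)) →
          κ = 8 / 3)) →
    (∀ (D : DobrushinDomain) (x₀ : ℂ) (ρ₀ : ℝ), 0 < ρ₀ →
      D.carrier ∩ Metric.ball x₀ ρ₀ = {z : ℂ | x₀.im < z.im} ∩ Metric.ball x₀ ρ₀ →
      x₀ ≠ D.pt 0 → x₀ ≠ D.pt 1 →
      ∀ (φ : ConformalEquiv upperHalfPlaneSet D.carrier), D.IsChordalUniformizing φ →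
        ∃ u₀ L η : ℝ, u₀ ≠ 0 ∧ 0 < L ∧ 0 < η ∧
          ∀ u : ℂ, 0 ≤ u.im →
            (dist u (u₀ : ℂ) < η →
                dist (φ.boundaryExtension u) x₀ ≤ L * dist u (u₀ : ℂ)) ∧
            (dist (φ.boundaryExtension u) x₀ < η →
                dist u (u₀ : ℂ) ≤ L * dist (φ.boundaryExtension u) x₀)) →
    ∀ (κ : ℝ≥0) (D : DobrushinDomain) (μ : Measure (CurveClass ℂ)) (x₀ : ℂ) (ρ₀ : ℝ),
      0 < κ → IsSLELaw κ D μ → 0 < ρ₀ →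
      D.carrier ∩ Metric.ball x₀ ρ₀ = {z : ℂ | x₀.im < z.im} ∩ Metric.ball x₀ ρ₀ →
      x₀ ≠ D.pt 0 → x₀ ≠ D.pt 1 →
      (∀ ε : ℝ, 0 < ε → 0 < μ {γ | Metric.infDist x₀ γ.range < ε}) ∧
        ((∃ c C r₀ : ℝ, 0 < c ∧ 0 < r₀ ∧ ∀ r ∈ Set.Ioo (0 : ℝ) r₀,
            ENNReal.ofReal (c * r ^ 2) ≤ μ {γ | Metric.infDist x₀ γ.range ≤ r} ∧
              μ {γ | Metric.infDist x₀ γ.range < r} ≤ ENNReal.ofReal (C * r ^ 2)) →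
          κ = 8 / 3) :=
  _root_.Summit.CriticalPhenomena.SAWScalingLimit.Theorems.SubseqIdentification.BoundaryAreaLaw.stub_kappaPinGlue

/-- **S6 — THE κ-PIN: boundary exponent `8/κ − 1 = 2 ⇔ κ = 8/3` (known SLE theory), DERIVED from the
three registered stubs S6a `stub_kappaPinHalfPlane`, S6b `stub_windowTransport`, S6c
`stub_kappaPinGlue` (lead reshape of generation 2's single L-stub into independently provable parts).**
Let `μ` be the chordal SLE_κ law (`κ > 0`) of a Dobrushin domain `(D; a, b)` having a flat horizontal
window `D ∩ B(x₀, ρ₀) = {Im z > Im x₀} ∩ B(x₀, ρ₀)` at `x₀ ∉ {a, b}`. Then (i) NON-DEGENERACY: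
`μ[dist(x₀, trace) < ε] > 0` for every `ε > 0`; and (ii) PIN: a two-sided area law
`c r² ≤ μ[dist ≤ r]`, `μ[dist < r] ≤ C r²` for small `r` forces `κ = 8/3`. [folklore] -/
theorem stub_kappaPin :
    ∀ (κ : ℝ≥0) (D : DobrushinDomain) (μ : Measure (CurveClass ℂ)) (x₀ : ℂ) (ρ₀ : ℝ),
      0 < κ → IsSLELaw κ D μ → 0 < ρ₀ →
      D.carrier ∩ Metric.ball x₀ ρ₀ = {z : ℂ | x₀.im < z.im} ∩ Metric.ball x₀ ρ₀ →
      x₀ ≠ D.pt 0 → x₀ ≠ D.pt 1 →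
      (∀ ε : ℝ, 0 < ε → 0 < μ {γ | Metric.infDist x₀ γ.range < ε}) ∧
        ((∃ c C r₀ : ℝ, 0 < c ∧ 0 < r₀ ∧ ∀ r ∈ Set.Ioo (0 : ℝ) r₀,
            ENNReal.ofReal (c * r ^ 2) ≤ μ {γ | Metric.infDist x₀ γ.range ≤ r} ∧
              μ {γ | Metric.infDist x₀ γ.range < r} ≤ ENNReal.ofReal (C * r ^ 2)) →
          κ = 8 / 3) :=
  stub_kappaPinGlue stub_kappaPinHalfPlane stub_windowTransport

/-! ## The named input T′: tightness gives subsequential limits (Prokhorov along the mesh; sorry-free) -/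

/-- **`EventualTight` ⇒ subsequential limits exist along every mesh sequence** (generation 1's stub S3,
now DERIVED from the route's registered target T′ = stmt-CriticalPhenomena-1372): for every Dobrushin domain, endpoint
approximation and `s → 0⁺` there are a subsequence `s ∘ φ` and a probability measure `μ` on `CurveClass ℂ`
such that the pushed critical SAW laws converge weakly to `μ` along `s ∘ φ`. Re-hosts the disprover's
`exists_subseqConv_of_isTightAlongMesh` / `isTightAlongMesh_of_eventualTight` (Disproof cycle 2 §5.4):
the laws are probability measures past the junk meshes (`Negative.eventually_isProbabilityMeasure_law`),
`EventualTight` gives tightness along the mesh (`isTightAlongMesh_of_isTightMeasureSet_image`), the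
sequence of image laws is a tight set (`isTightMeasureSet_range_of_eventually`), and Prokhorov on the
Polish `CurveClass ℂ` (`isCompact_closure_of_isTightMeasureSet`) extracts the subsequence. [folklore] -/
theorem subseqLimitsExist_of_eventualTight (hT : EventualTight) :
    ∀ (D : DobrushinDomain) (a b : ℝ → Site 2), SAW.IsEndpointApprox D a b →
      ∀ (s : ℕ → ℝ), Tendsto s atTop (𝓝[>] (0 : ℝ)) →
        ∃ φ : ℕ → ℕ, StrictMono φ ∧ ∃ μ : Measure (CurveClass ℂ), IsProbabilityMeasure μ ∧
          ∀ f : CurveClass ℂ →ᵇ ℝ,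
            Tendsto (fun n => ∫ γ, f γ.curve
                ∂(SAW.law D.carrier (s (φ n)) (a (s (φ n))) (b (s (φ n)))))
              atTop (𝓝 (∫ x, f x ∂μ)) := by
  intro D a b hab s hs
  -- tightness along the mesh, from the route's `EventualTight`
  have hT' : IsTightAlongMesh (fun δ (γ : SAW.DomainSAW D.carrier δ (a δ) (b δ)) => γ.curve)
      (fun δ => SAW.law D.carrier δ (a δ) (b δ)) := by
    obtain ⟨δ₀, hδ₀, h⟩ := hT D a b hab
    exact isTightAlongMesh_of_isTightMeasureSet_image
      (Eventually.of_forall fun δ => (SAW.DomainSAW.measurable_of_top _).aemeasurable) hδ₀ h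
  -- past some index the laws are probability measures
  obtain ⟨N, hN⟩ := eventually_atTop.1 (hs.eventually
    (Summit.CriticalPhenomena.SAWScalingLimit.Theorems.SubseqIdentification.Negative.eventually_isProbabilityMeasure_law
      hab))
  have hN' : ∀ n, IsProbabilityMeasure (SAW.law D.carrier (s (n + N)) (a (s (n + N))) (b (s (n + N)))) :=
    fun n => hN _ (N.le_add_left n)
  let ν : ℕ → ProbabilityMeasure (CurveClass ℂ) := fun n =>
    ⟨(SAW.law D.carrier (s (n + N)) (a (s (n + N))) (b (s (n + N)))).map (fun γ => γ.curve),
      Measure.isProbabilityMeasure_map (SAW.DomainSAW.measurable_of_top _).aemeasurable⟩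
  have hνapply : ∀ n (K : Set (CurveClass ℂ)), IsClosed K → (ν n : Measure (CurveClass ℂ)) Kᶜ =
      SAW.law D.carrier (s (n + N)) (a (s (n + N))) (b (s (n + N))) ((fun γ => γ.curve) ⁻¹' Kᶜ) :=
    fun n K hK => Measure.map_apply (SAW.DomainSAW.measurable_of_top _) hK.isOpen_compl.measurableSet
  have htight : IsTightMeasureSet
      {((μ : ProbabilityMeasure (CurveClass ℂ)) : Measure (CurveClass ℂ)) | μ ∈ Set.range ν} := by
    have hrange : {((μ : ProbabilityMeasure (CurveClass ℂ)) : Measure (CurveClass ℂ)) | μ ∈ Set.range ν}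
        = Set.range (fun n => (ν n : Measure (CurveClass ℂ))) := by
      ext x
      simp only [Set.mem_range, Set.mem_setOf_eq]
      constructor
      · rintro ⟨μ, ⟨n, rfl⟩, rfl⟩
        exact ⟨n, rfl⟩
      · rintro ⟨n, rfl⟩
        exact ⟨ν n, ⟨n, rfl⟩, rfl⟩
    rw [hrange]
    haveI : ∀ n, IsFiniteMeasure ((fun n => (ν n : Measure (CurveClass ℂ))) n) := fun n => by
      change IsFiniteMeasure (ν n : Measure (CurveClass ℂ))
      infer_instance
    refine isTightMeasureSet_range_of_eventually fun ε hε => ?_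
    obtain ⟨K, hK, hev⟩ := hT' ε hε
    refine ⟨K, hK, ?_⟩
    have hs' : Tendsto (fun n => s (n + N)) atTop (𝓝[>] (0 : ℝ)) := hs.comp (tendsto_add_atTop_nat N)
    filter_upwards [hs'.eventually hev] with n hn
    rwa [hνapply n K hK.isClosed]
  have hcomp := isCompact_closure_of_isTightMeasureSet htight
  obtain ⟨μ, -, φ, hφ, hlim⟩ := hcomp.isSeqCompact fun n => subset_closure (Set.mem_range_self n)
  refine ⟨fun n => φ n + N, fun m n hmn => Nat.add_lt_add_right (hφ hmn) N, μ, inferInstance,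
    fun f => ?_⟩
  have := (ProbabilityMeasure.tendsto_iff_forall_integral_tendsto.1 hlim) f
  refine this.congr fun n => ?_
  change ∫ x, f x ∂((SAW.law D.carrier (s (φ n + N)) (a (s (φ n + N))) (b (s (φ n + N)))).map
    (fun γ => γ.curve)) = _
  exact integral_map (SAW.DomainSAW.measurable_of_top _).aemeasurable f.continuous.aestronglyMeasurable

/-! ## The composition -/

/-- **Composition `S1 → S2 → (T′-consequence) → S4 → S5 → S6 → SubseqIdentification` (kernel-checked, no
`sorry`).** Given the crux hypotheses for `(D; a, b)`, `s`, `μ`: take the reference square `(D₀; a₀, b₀)`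
with its flat window at `x₀` (S2) and a subsequential limit `μ₀` of its SAW laws along `s ∘ φ` (h₃, the
consequence of T′); the dock (S1) applied to the sequence `s ∘ φ` gives ONE `κ > 0` with `μ = SLE_κ(D)`
(the laws in `D` still converge to `μ` along the subsequence) and `μ₀ = SLE_κ(D₀)`; the lattice area law in
`D₀` at `x₀` (S4), transported along `s ∘ φ` (`Tendsto.eventually`, radius by radius) and passed to the
limit (S5, with non-degeneracy from S6 (i)), gives the two-sided `r²` law for `μ₀`, and the pin (S6 (ii))
gives `κ = 8/3`; hence `IsSLELaw (8/3) D μ`, which is `SAWParafermion.SubseqIdentification` BY NAME (the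
ledger's primary decl of stmt-CriticalPhenomena-0783; the identical shared decl `SAWRenewalTightness.SubseqIdentification`
follows definitionally, `SubseqIdentification_renewalTightness`). -/
theorem SubseqIdentification_of
    (h₁ : ∀ (s : ℕ → ℝ), Tendsto s atTop (𝓝[>] (0 : ℝ)) →
      ∃ κ : ℝ≥0, 0 < κ ∧
        ∀ (D : DobrushinDomain) (a b : ℝ → Site 2), SAW.IsEndpointApprox D a b →
          ∀ (μ : Measure (CurveClass ℂ)), IsProbabilityMeasure μ →
            (∀ f : CurveClass ℂ →ᵇ ℝ,
              Tendsto (fun n => ∫ γ, f γ.curve ∂(SAW.law D.carrier (s n) (a (s n)) (b (s n))))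
                atTop (𝓝 (∫ x, f x ∂μ))) →
            IsSLELaw κ D μ)
    (h₂ : ∃ (D₀ : DobrushinDomain) (a₀ b₀ : ℝ → Site 2) (x₀ : ℂ) (ρ₀ : ℝ),
      SAW.IsEndpointApprox D₀ a₀ b₀ ∧ 0 < ρ₀ ∧ x₀ ≠ D₀.pt 0 ∧ x₀ ≠ D₀.pt 1 ∧
        D₀.carrier ∩ Metric.ball x₀ ρ₀ = {z : ℂ | x₀.im < z.im} ∩ Metric.ball x₀ ρ₀)
    (h₃ : ∀ (D : DobrushinDomain) (a b : ℝ → Site 2), SAW.IsEndpointApprox D a b →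
      ∀ (s : ℕ → ℝ), Tendsto s atTop (𝓝[>] (0 : ℝ)) →
        ∃ φ : ℕ → ℕ, StrictMono φ ∧ ∃ μ : Measure (CurveClass ℂ), IsProbabilityMeasure μ ∧
          ∀ f : CurveClass ℂ →ᵇ ℝ,
            Tendsto (fun n => ∫ γ, f γ.curve
                ∂(SAW.law D.carrier (s (φ n)) (a (s (φ n))) (b (s (φ n)))))
              atTop (𝓝 (∫ x, f x ∂μ)))
    (h₄ : ∀ (D : DobrushinDomain) (a b : ℝ → Site 2), SAW.IsEndpointApprox D a b →
      ∀ (x₀ : ℂ) (ρ₀ : ℝ), 0 < ρ₀ →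
        D.carrier ∩ Metric.ball x₀ ρ₀ = {z : ℂ | x₀.im < z.im} ∩ Metric.ball x₀ ρ₀ →
        x₀ ≠ D.pt 0 → x₀ ≠ D.pt 1 →
        ∃ C ε₀ : ℝ, 0 < C ∧ 0 < ε₀ ∧ ∀ r : ℝ, 0 < r → r ≤ ε₀ →
          ∀ᶠ δ in 𝓝[>] (0 : ℝ),
            SAW.law D.carrier δ (a δ) (b δ) {γ | Metric.infDist x₀ γ.curve.range ≤ r} *
                ENNReal.ofReal (ε₀ ^ 2) ≤
              ENNReal.ofReal C *
                SAW.law D.carrier δ (a δ) (b δ) {γ | Metric.infDist x₀ γ.curve.range ≤ ε₀} *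
                  ENNReal.ofReal (r ^ 2) ∧
            SAW.law D.carrier δ (a δ) (b δ) {γ | Metric.infDist x₀ γ.curve.range ≤ ε₀} *
                ENNReal.ofReal (r ^ 2) ≤
              ENNReal.ofReal C *
                SAW.law D.carrier δ (a δ) (b δ) {γ | Metric.infDist x₀ γ.curve.range ≤ r} *
                  ENNReal.ofReal (ε₀ ^ 2))
    (h₅ : ∀ (D : DobrushinDomain) (a b : ℝ → Site 2) (s : ℕ → ℝ) (μ : Measure (CurveClass ℂ))
        (x₀ : ℂ),
      Tendsto s atTop (𝓝[>] (0 : ℝ)) → IsProbabilityMeasure μ →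
      (∀ f : CurveClass ℂ →ᵇ ℝ,
        Tendsto (fun n => ∫ γ, f γ.curve ∂(SAW.law D.carrier (s n) (a (s n)) (b (s n))))
          atTop (𝓝 (∫ x, f x ∂μ))) →
      (∃ C ε₀ : ℝ, 0 < C ∧ 0 < ε₀ ∧ ∀ r : ℝ, 0 < r → r ≤ ε₀ → ∀ᶠ n in atTop,
          SAW.law D.carrier (s n) (a (s n)) (b (s n)) {γ | Metric.infDist x₀ γ.curve.range ≤ r} *
                ENNReal.ofReal (ε₀ ^ 2) ≤
              ENNReal.ofReal C *
                SAW.law D.carrier (s n) (a (s n)) (b (s n))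
                    {γ | Metric.infDist x₀ γ.curve.range ≤ ε₀} *
                  ENNReal.ofReal (r ^ 2) ∧
            SAW.law D.carrier (s n) (a (s n)) (b (s n)) {γ | Metric.infDist x₀ γ.curve.range ≤ ε₀} *
                ENNReal.ofReal (r ^ 2) ≤
              ENNReal.ofReal C *
                SAW.law D.carrier (s n) (a (s n)) (b (s n))
                    {γ | Metric.infDist x₀ γ.curve.range ≤ r} *
                  ENNReal.ofReal (ε₀ ^ 2)) →
      (∀ ε : ℝ, 0 < ε → 0 < μ {γ | Metric.infDist x₀ γ.range < ε}) →
      ∃ c C r₀ : ℝ, 0 < c ∧ 0 < r₀ ∧ ∀ r ∈ Set.Ioo (0 : ℝ) r₀,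
        ENNReal.ofReal (c * r ^ 2) ≤ μ {γ | Metric.infDist x₀ γ.range ≤ r} ∧
          μ {γ | Metric.infDist x₀ γ.range < r} ≤ ENNReal.ofReal (C * r ^ 2))
    (h₆ : ∀ (κ : ℝ≥0) (D : DobrushinDomain) (μ : Measure (CurveClass ℂ)) (x₀ : ℂ) (ρ₀ : ℝ),
      0 < κ → IsSLELaw κ D μ → 0 < ρ₀ →
      D.carrier ∩ Metric.ball x₀ ρ₀ = {z : ℂ | x₀.im < z.im} ∩ Metric.ball x₀ ρ₀ →
      x₀ ≠ D.pt 0 → x₀ ≠ D.pt 1 →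
      (∀ ε : ℝ, 0 < ε → 0 < μ {γ | Metric.infDist x₀ γ.range < ε}) ∧
        ((∃ c C r₀ : ℝ, 0 < c ∧ 0 < r₀ ∧ ∀ r ∈ Set.Ioo (0 : ℝ) r₀,
            ENNReal.ofReal (c * r ^ 2) ≤ μ {γ | Metric.infDist x₀ γ.range ≤ r} ∧
              μ {γ | Metric.infDist x₀ γ.range < r} ≤ ENNReal.ofReal (C * r ^ 2)) →
          κ = 8 / 3)) :
    SubseqIdentification := by
  intro D a b hab s μ hs hμ hlim
  -- S2: the reference square with its flat window
  obtain ⟨D₀, a₀, b₀, x₀, ρ₀, hab₀, hρ₀, hx0, hx1, hwin⟩ := h₂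
  -- T′-consequence: a subsequential limit in the reference domain along `s ∘ φ`
  obtain ⟨φ, hφ, μ₀, hμ₀, hlim₀⟩ := h₃ D₀ a₀ b₀ hab₀ s hs
  have hs' : Tendsto (s ∘ φ) atTop (𝓝[>] (0 : ℝ)) := hs.comp hφ.tendsto_atTop
  -- S1: one `κ` along `s ∘ φ` for both `D` and `D₀`
  obtain ⟨κ, hκ, hdock⟩ := h₁ (s ∘ φ) hs'
  have hD : IsSLELaw κ D μ :=
    hdock D a b hab μ hμ fun f => (hlim f).comp hφ.tendsto_atTop
  have hD₀ : IsSLELaw κ D₀ μ₀ := hdock D₀ a₀ b₀ hab₀ μ₀ hμ₀ hlim₀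
  -- S4: the lattice area law in the reference domain, transported radius by radius along the subsequence
  obtain ⟨C, ε₀, hC, hε₀, hlaw⟩ := h₄ D₀ a₀ b₀ hab₀ x₀ ρ₀ hρ₀ hwin hx0 hx1
  -- S6: non-degeneracy and the pin for `μ₀ = SLE_κ(D₀)`
  obtain ⟨hnd, hpin⟩ := h₆ κ D₀ μ₀ x₀ ρ₀ hκ hD₀ hρ₀ hwin hx0 hx1
  -- S5: the continuum two-sided `r²` law for `μ₀`
  have htwo := h₅ D₀ a₀ b₀ (s ∘ φ) μ₀ x₀ hs' hμ₀ hlim₀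
    ⟨C, ε₀, hC, hε₀, fun r hr hrε => hs'.eventually (hlaw r hr hrε)⟩ hnd
  have hk : κ = 8 / 3 := hpin htwo
  rw [hk] at hD
  exact hD

/-- **`<Crux>_proof`**: the composition instantiated with the registered stubs of this file and the route's
registered target T′ (`SAWRenewalTightness.EventualTight`, stmt-CriticalPhenomena-1372, taken BY NAME) — the line closes the
crux BY NAME (`SAWParafermion.SubseqIdentification`, primary decl of stmt-CriticalPhenomena-0783) as soon as every `stub_*`
is proved and T′ has landed. -/
theorem SubseqIdentification_proof (hT : EventualTight) : SubseqIdentification :=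
  SubseqIdentification_of stub_identificationUpToKappa stub_referenceWindow
    (subseqLimitsExist_of_eventualTight hT) stub_latticeAreaLaw stub_areaLawOfLimit stub_kappaPin

/-- The shared decl of route `SAWRenewalTightness` (payload route; identical body, deduplicated by the ledger)
is closed by the same term, definitionally — and there T′ is the route's own rank-0 target, the other
hypothesis of its deciding theorem `closes (hT : EventualTight) (hI : SubseqIdentification)`. -/
theorem SubseqIdentification_renewalTightness (hT : EventualTight) :
    Summit.CriticalPhenomena.SAWScalingLimit.Theses.SAWRenewalTightness.SubseqIdentification :=
  SubseqIdentification_proof hT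

/-! ## Sanity anchors (sorry-free) -/

/-- The dock S1 with `κ := 8/3` IS implied by the crux (so S1 is weaker than, not a restatement of, the
crux; and it is true if the LSW conjecture is). [folklore] -/
theorem identificationUpToKappa_of_crux (h : SubseqIdentification) :
    ∀ (s : ℕ → ℝ), Tendsto s atTop (𝓝[>] (0 : ℝ)) →
      ∃ κ : ℝ≥0, 0 < κ ∧
        ∀ (D : DobrushinDomain) (a b : ℝ → Site 2), SAW.IsEndpointApprox D a b →
          ∀ (μ : Measure (CurveClass ℂ)), IsProbabilityMeasure μ →
            (∀ f : CurveClass ℂ →ᵇ ℝ,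
              Tendsto (fun n => ∫ γ, f γ.curve ∂(SAW.law D.carrier (s n) (a (s n)) (b (s n))))
                atTop (𝓝 (∫ x, f x ∂μ))) →
            IsSLELaw κ D μ :=
  fun s hs => ⟨8 / 3, by positivity, fun D a b hab μ hμ hlim => h D a b hab s μ hs hμ hlim⟩

/-- **The fixed-mesh area law implies the registered stub S4.** The idea card's / generation 1's form of the
area law — ONE pair of constants for all small meshes `δ` and ALL mesoscopic radii `2δ ≤ r ≤ r' ≤ ε₀` at
once (what the peeling mechanism actually delivers) — implies the pointwise-in-`r` form registered as
`stub_latticeAreaLaw` (take `r' = ε₀`; for fixed `r > 0`, eventually `2δ ≤ r`). A prover who proves the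
fixed-mesh law closes S4 through this lemma. [folklore] -/
theorem latticeAreaLaw_of_fixedMesh {D : DobrushinDomain} {a b : ℝ → Site 2} {x₀ : ℂ}
    (h : ∃ C ε₀ : ℝ, 0 < C ∧ 0 < ε₀ ∧ ∀ᶠ δ in 𝓝[>] (0 : ℝ), ∀ r r' : ℝ,
          2 * δ ≤ r → r ≤ r' → r' ≤ ε₀ →
          SAW.law D.carrier δ (a δ) (b δ) {γ | Metric.infDist x₀ γ.curve.range ≤ r} *
                ENNReal.ofReal (r' ^ 2) ≤
              ENNReal.ofReal C *
                SAW.law D.carrier δ (a δ) (b δ) {γ | Metric.infDist x₀ γ.curve.range ≤ r'} *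
                  ENNReal.ofReal (r ^ 2) ∧
            SAW.law D.carrier δ (a δ) (b δ) {γ | Metric.infDist x₀ γ.curve.range ≤ r'} *
                ENNReal.ofReal (r ^ 2) ≤
              ENNReal.ofReal C *
                SAW.law D.carrier δ (a δ) (b δ) {γ | Metric.infDist x₀ γ.curve.range ≤ r} *
                  ENNReal.ofReal (r' ^ 2)) :
    ∃ C ε₀ : ℝ, 0 < C ∧ 0 < ε₀ ∧ ∀ r : ℝ, 0 < r → r ≤ ε₀ →
      ∀ᶠ δ in 𝓝[>] (0 : ℝ),
        SAW.law D.carrier δ (a δ) (b δ) {γ | Metric.infDist x₀ γ.curve.range ≤ r} *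
            ENNReal.ofReal (ε₀ ^ 2) ≤
          ENNReal.ofReal C *
            SAW.law D.carrier δ (a δ) (b δ) {γ | Metric.infDist x₀ γ.curve.range ≤ ε₀} *
              ENNReal.ofReal (r ^ 2) ∧
        SAW.law D.carrier δ (a δ) (b δ) {γ | Metric.infDist x₀ γ.curve.range ≤ ε₀} *
            ENNReal.ofReal (r ^ 2) ≤
          ENNReal.ofReal C *
            SAW.law D.carrier δ (a δ) (b δ) {γ | Metric.infDist x₀ γ.curve.range ≤ r} *
              ENNReal.ofReal (ε₀ ^ 2) := by
  obtain ⟨C, ε₀, hC, hε₀, hlaw⟩ := h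
  refine ⟨C, ε₀, hC, hε₀, fun r hr hrε => ?_⟩
  have hsmall : ∀ᶠ δ in 𝓝[>] (0 : ℝ), 2 * δ ≤ r := by
    have h2 : ∀ᶠ δ in 𝓝 (0 : ℝ), δ < r / 2 := eventually_lt_nhds (by linarith)
    exact (h2.filter_mono nhdsWithin_le_nhds).mono fun δ hδ => by linarith
  filter_upwards [hlaw, hsmall] with δ hδ h2δ
  exact hδ r ε₀ h2δ hrε le_rfl

/-! ## Necessity (lead c3, cycle 1): the reduction is EXACT modulo `EventualTight` (composed from the landed pieces; same terms as the assembly `Theorems/SAWRenewalTightnessSubseqIdentificationNecessity.lean` p130606) -/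

/-- **S4 is implied by the conjecture**: `SAW.SAWScalingLimit → stub_latticeAreaLaw`. [folklore] -/
theorem latticeAreaLaw_of_sawScalingLimit (h : SAW.SAWScalingLimit) :
    ∀ (D : DobrushinDomain) (a b : ℝ → Site 2), SAW.IsEndpointApprox D a b →
      ∀ (x₀ : ℂ) (ρ₀ : ℝ), 0 < ρ₀ →
        D.carrier ∩ Metric.ball x₀ ρ₀ = {z : ℂ | x₀.im < z.im} ∩ Metric.ball x₀ ρ₀ →
        x₀ ≠ D.pt 0 → x₀ ≠ D.pt 1 →
        ∃ C ε₀ : ℝ, 0 < C ∧ 0 < ε₀ ∧ ∀ r : ℝ, 0 < r → r ≤ ε₀ →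
          ∀ᶠ δ in 𝓝[>] (0 : ℝ),
            SAW.law D.carrier δ (a δ) (b δ) {γ | Metric.infDist x₀ γ.curve.range ≤ r} *
                ENNReal.ofReal (ε₀ ^ 2) ≤
              ENNReal.ofReal C *
                SAW.law D.carrier δ (a δ) (b δ) {γ | Metric.infDist x₀ γ.curve.range ≤ ε₀} *
                  ENNReal.ofReal (r ^ 2) ∧
            SAW.law D.carrier δ (a δ) (b δ) {γ | Metric.infDist x₀ γ.curve.range ≤ ε₀} *
                ENNReal.ofReal (r ^ 2) ≤
              ENNReal.ofReal C *
                SAW.law D.carrier δ (a δ) (b δ) {γ | Metric.infDist x₀ γ.curve.range ≤ r} *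
                  ENNReal.ofReal (ε₀ ^ 2) :=
  _root_.Summit.CriticalPhenomena.SAWScalingLimit.Theorems.SubseqIdentification.BoundaryAreaLaw.stub_latticeAreaLawNecessityGlue
    (_root_.Summit.CriticalPhenomena.SAWScalingLimit.Theorems.SubseqIdentification.BoundaryAreaLaw.stub_sleAreaLawGlue _root_.Summit.CriticalPhenomena.SAWScalingLimit.Theorems.SubseqIdentification.BoundaryAreaLaw.stub_sleHalfPlaneAreaLaw
      _root_.Summit.CriticalPhenomena.SAWScalingLimit.Theorems.SubseqIdentification.BoundaryAreaLaw.stub_windowTransport)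
    _root_.Summit.CriticalPhenomena.SAWScalingLimit.Theorems.SubseqIdentification.BoundaryAreaLaw.stub_latticeAreaLawOfLimitLaw h

/-- **crux ↔ S1 ∧ S4 under T′.** Modulo `EventualTight` the crux is EQUIVALENT to the conjunction of the two
residual registered stubs of this skeleton, `stub_identificationUpToKappa` (S1) and `stub_latticeAreaLaw` (S4):
the landed `Theorems.SubseqIdentification.BoundaryAreaLaw.subseqIdentification_iff_dock_and_latticeAreaLaw`. [folklore] -/
theorem subseqIdentification_iff_stubs (hT : EventualTight) :
    SubseqIdentification ↔
      ((∀ (s : ℕ → ℝ), Tendsto s atTop (𝓝[>] (0 : ℝ)) →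
          ∃ κ : ℝ≥0, 0 < κ ∧
            ∀ (D : DobrushinDomain) (a b : ℝ → Site 2), SAW.IsEndpointApprox D a b →
              ∀ (μ : Measure (CurveClass ℂ)), IsProbabilityMeasure μ →
                (∀ f : CurveClass ℂ →ᵇ ℝ,
                  Tendsto (fun n => ∫ γ, f γ.curve ∂(SAW.law D.carrier (s n) (a (s n)) (b (s n))))
                    atTop (𝓝 (∫ x, f x ∂μ))) →
                IsSLELaw κ D μ) ∧
        (∀ (D : DobrushinDomain) (a b : ℝ → Site 2), SAW.IsEndpointApprox D a b →
          ∀ (x₀ : ℂ) (ρ₀ : ℝ), 0 < ρ₀ →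
            D.carrier ∩ Metric.ball x₀ ρ₀ = {z : ℂ | x₀.im < z.im} ∩ Metric.ball x₀ ρ₀ →
            x₀ ≠ D.pt 0 → x₀ ≠ D.pt 1 →
            ∃ C ε₀ : ℝ, 0 < C ∧ 0 < ε₀ ∧ ∀ r : ℝ, 0 < r → r ≤ ε₀ →
              ∀ᶠ δ in 𝓝[>] (0 : ℝ),
                SAW.law D.carrier δ (a δ) (b δ) {γ | Metric.infDist x₀ γ.curve.range ≤ r} *
                    ENNReal.ofReal (ε₀ ^ 2) ≤
                  ENNReal.ofReal C *
                    SAW.law D.carrier δ (a δ) (b δ) {γ | Metric.infDist x₀ γ.curve.range ≤ ε₀} *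
                      ENNReal.ofReal (r ^ 2) ∧
                SAW.law D.carrier δ (a δ) (b δ) {γ | Metric.infDist x₀ γ.curve.range ≤ ε₀} *
                    ENNReal.ofReal (r ^ 2) ≤
                  ENNReal.ofReal C *
                    SAW.law D.carrier δ (a δ) (b δ) {γ | Metric.infDist x₀ γ.curve.range ≤ r} *
                      ENNReal.ofReal (ε₀ ^ 2))) :=
  ⟨fun hI => ⟨_root_.Summit.CriticalPhenomena.SAWScalingLimit.Theorems.SubseqIdentification.BoundaryAreaLaw.stub_dockOfCrux hI,
      latticeAreaLaw_of_sawScalingLimit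
        (Summit.CriticalPhenomena.SAWScalingLimit.Theses.SAWRenewalTightness.closes hT hI)⟩,
    fun h => _root_.Summit.CriticalPhenomena.SAWScalingLimit.Theorems.SubseqIdentification.BoundaryAreaLaw.SubseqIdentification_of_dock_of_latticeAreaLaw h.1 h.2 hT⟩

/-- **The summit conjunct decomposed: `SAWScalingLimit ↔ EventualTight ∧ S1 ∧ S4`** (by name from the landed
assembly). The Lawler–Schramm–Werner conjecture on `δℤ²` as typed is exactly: tightness of the critical SAW laws ∧
identification of subsequential limits up to κ ∧ the lattice boundary area law. [folklore] -/
theorem sawScalingLimit_iff_stubs :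
    SAW.SAWScalingLimit ↔
      (EventualTight ∧
        (∀ (s : ℕ → ℝ), Tendsto s atTop (𝓝[>] (0 : ℝ)) →
            ∃ κ : ℝ≥0, 0 < κ ∧
              ∀ (D : DobrushinDomain) (a b : ℝ → Site 2), SAW.IsEndpointApprox D a b →
                ∀ (μ : Measure (CurveClass ℂ)), IsProbabilityMeasure μ →
                  (∀ f : CurveClass ℂ →ᵇ ℝ,
                    Tendsto (fun n => ∫ γ, f γ.curve ∂(SAW.law D.carrier (s n) (a (s n)) (b (s n))))
                      atTop (𝓝 (∫ x, f x ∂μ))) →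
                  IsSLELaw κ D μ) ∧
        (∀ (D : DobrushinDomain) (a b : ℝ → Site 2), SAW.IsEndpointApprox D a b →
            ∀ (x₀ : ℂ) (ρ₀ : ℝ), 0 < ρ₀ →
              D.carrier ∩ Metric.ball x₀ ρ₀ = {z : ℂ | x₀.im < z.im} ∩ Metric.ball x₀ ρ₀ →
              x₀ ≠ D.pt 0 → x₀ ≠ D.pt 1 →
              ∃ C ε₀ : ℝ, 0 < C ∧ 0 < ε₀ ∧ ∀ r : ℝ, 0 < r → r ≤ ε₀ →
                ∀ᶠ δ in 𝓝[>] (0 : ℝ),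
                  SAW.law D.carrier δ (a δ) (b δ) {γ | Metric.infDist x₀ γ.curve.range ≤ r} *
                      ENNReal.ofReal (ε₀ ^ 2) ≤
                    ENNReal.ofReal C *
                      SAW.law D.carrier δ (a δ) (b δ)
                          {γ | Metric.infDist x₀ γ.curve.range ≤ ε₀} *
                        ENNReal.ofReal (r ^ 2) ∧
                  SAW.law D.carrier δ (a δ) (b δ) {γ | Metric.infDist x₀ γ.curve.range ≤ ε₀} *
                      ENNReal.ofReal (r ^ 2) ≤
                    ENNReal.ofReal C *
                      SAW.law D.carrier δ (a δ) (b δ)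
                          {γ | Metric.infDist x₀ γ.curve.range ≤ r} *
                        ENNReal.ofReal (ε₀ ^ 2))) :=
  ⟨fun h =>
    ⟨fun D a b hab =>
        Summit.CriticalPhenomena.SAWScalingLimit.Theorems.EventualTight.Negative.exists_isTightMeasureSet_image_of_convergesInLawToSLE
          hab (h D a b hab),
      _root_.Summit.CriticalPhenomena.SAWScalingLimit.Theorems.SubseqIdentification.BoundaryAreaLaw.stub_dockOfCrux
        (Summit.CriticalPhenomena.SAWScalingLimit.Theorems.SubseqIdentification.Negative.subseqIdentification_of_sawScalingLimit h),
      latticeAreaLaw_of_sawScalingLimit h⟩,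
    fun h => Summit.CriticalPhenomena.SAWScalingLimit.Theses.SAWRenewalTightness.closes h.1
      (_root_.Summit.CriticalPhenomena.SAWScalingLimit.Theorems.SubseqIdentification.BoundaryAreaLaw.SubseqIdentification_of_dock_of_latticeAreaLaw h.2.1 h.2.2 h.1)⟩


/-! ## Restriction reshape (lead c4, cycle 1, 2026-08-16/17): the κ-pin without the lattice LOWER bound

The registered pin consumes S4 in two halves: the lattice UPPER bound (first conjunct of `stub_latticeAreaLaw`,
"boundary rarity") gives `κ ≤ 8/3` (Beffara's lower estimate + Rohde–Schramm space filling), the lattice LOWER bound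
(second conjunct) gives `κ ≥ 8/3` (Alberts–Kozdron). The reshape below keeps the first half as the stub S4⁺
`stub_latticeAreaUpperBound` (with its one-sided consumers S5⁺ `stub_areaUpperOfLimit`, S6⁺ `stub_kappaLeOfUpper`,
provable now from the landed p96448/p96666/p96955/p96964) and REPLACES the second half by the Lawler–Schramm–Werner
RESTRICTION pin (Disproof cycle 2 §8 item 9): the critical SAW law has the EXACT domain-restriction property on the
lattice (`SAW.law_setOf_exists_support_eq_eq`, tree), it passes to subsequential limits for the carved sub-domains
`D_r = D ∖ B̄(x₀, r)` at a flat window (RS2a `stub_halfBallSubdomain` — the carved Dobrushin domain; RS2b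
`stub_halfBallNesting` — lattice nesting, endpoint transfer and the sandwich of the confinement event between
`{dist(x₀, trace) > r}` and `{≥ r}`; RS3 `stub_restrictionPassage` — portmanteau, valid at every radius `r` that is not
an atom of `dist(x₀, trace)` under the limit, hence at all but countably many `r`; NO SLE input), and among the
chordal SLE_κ families with `κ ≤ 4` the restriction identity singles out `κ = 8/3` (RS5 `stub_sleRestrictionRigidity`:
LSW03 Prop. 5.3 / Thm. 6.5 — the compensator `exp(λ ∫ Sh/6)` with `λ = (8 − 3κ)(6 − κ)/(2κ) ≠ 0` is non-degenerate — the
SLE-side debt of this sub-line, CLOSED mathematics, not a lattice conjecture). Composition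
`SubseqIdentification_of_restriction`: S1 → S2 → T′ → S4⁺ → S5⁺ → S6⁺ → RS2a → RS2b → RS3 → RS5 → crux (sorry-free over its
hypotheses); `SubseqIdentification_proof_restriction (hT : EventualTight)` instantiates it. Residual of the line after
this reshape: S1 (dock) ∧ S4⁺ (one-sided lattice rarity bound) ∧ T′ ∧ RS5 (SLE theory). -/

/-- `c ↦ dist(x₀, trace c)` is `1`-Lipschitz on curve classes (pattern of the landed S5 file). [folklore] -/
theorem lipschitzWith_infDist_range_c4 (z : ℂ) :
    LipschitzWith 1 fun c : CurveClass ℂ => Metric.infDist z c.range := by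
  refine LipschitzWith.of_le_add fun c₁ c₂ => ?_
  obtain ⟨γ₁, rfl⟩ := CurveClass.surjective_mk c₁
  obtain ⟨γ₂, rfl⟩ := CurveClass.surjective_mk c₂
  simp only [CurveClass.range_mk, CurveClass.dist_mk_mk]
  have key : ∀ ⦃y⦄, y ∈ γ₂.range → Metric.infDist z γ₁.range - dist γ₁ γ₂ ≤ dist z y := by
    rintro y ⟨t, rfl⟩
    have h₁ := Curve.infDist_range_le γ₂ γ₁ t
    have h₂ := Metric.infDist_le_infDist_add_dist (s := γ₁.range) (x := z) (y := γ₂ t)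
    rw [dist_comm γ₂ γ₁] at h₁
    linarith
  have h := (Metric.le_infDist γ₂.range_nonempty).2 key
  linarith

/-- **A good radius exists**: for a finite measure `ν` on curve classes, a point `x₀` and `ρ > 0` there is a radius
`0 < r` with `4 r ≤ ρ` which is not an atom of `c ↦ dist(x₀, trace c)` under `ν` (the atoms form a countable set,
`Measure.countable_meas_level_set_pos`, while `(0, ρ/4)` is uncountable). [folklore] -/
theorem exists_radius_level_null (ν : Measure (CurveClass ℂ)) [IsFiniteMeasure ν] (x₀ : ℂ) {ρ : ℝ}
    (hρ : 0 < ρ) :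
    ∃ r : ℝ, 0 < r ∧ 4 * r ≤ ρ ∧ ν {c | Metric.infDist x₀ c.range = r} = 0 := by
  have hmeas : Measurable fun c : CurveClass ℂ => Metric.infDist x₀ c.range :=
    (lipschitzWith_infDist_range_c4 x₀).continuous.measurable
  have hcount : Set.Countable {t : ℝ | 0 < ν {c : CurveClass ℂ | Metric.infDist x₀ c.range = t}} :=
    Measure.countable_meas_level_set_pos hmeas
  have hunc : ¬ (Set.Ioo (0 : ℝ) (ρ / 4)).Countable := by
    rw [← Cardinal.le_aleph0_iff_set_countable, Cardinal.mk_Ioo_real (by positivity), not_le]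
    exact Cardinal.aleph0_lt_continuum
  obtain ⟨r, hr, hrS⟩ : ∃ r ∈ Set.Ioo (0 : ℝ) (ρ / 4),
      r ∉ {t : ℝ | 0 < ν {c : CurveClass ℂ | Metric.infDist x₀ c.range = t}} :=
    Set.not_subset.1 fun h => hunc (hcount.mono h)
  refine ⟨r, hr.1, by linarith [hr.2], ?_⟩
  simpa only [Set.mem_setOf_eq, not_lt, nonpos_iff_eq_zero] using hrS

/-- Windows shrink: the flat-window identity at radius `ρ` gives it at every `ρ' ≤ ρ`. [folklore] -/
theorem window_mono_c4 {V : Set ℂ} {x₀ : ℂ} {ρ ρ' : ℝ}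
    (hwin : V ∩ Metric.ball x₀ ρ = {z : ℂ | x₀.im < z.im} ∩ Metric.ball x₀ ρ) (h : ρ' ≤ ρ) :
    V ∩ Metric.ball x₀ ρ' = {z : ℂ | x₀.im < z.im} ∩ Metric.ball x₀ ρ' := by
  have hsub : Metric.ball x₀ ρ ∩ Metric.ball x₀ ρ' = Metric.ball x₀ ρ' :=
    Set.inter_eq_self_of_subset_right (Metric.ball_subset_ball h)
  rw [← hsub, ← Set.inter_assoc, hwin, Set.inter_assoc]

/-- **S4⁺ — THE LATTICE BOUNDARY RARITY BOUND (upper half of S4; OPEN, lattice).** For a Dobrushin domain with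
endpoint approximation and a flat horizontal window at `x₀ ∉ {a, b}` there are `C, ε₀ > 0` such that for every
`0 < r ≤ ε₀`, eventually as `δ → 0⁺`, `P_δ[dist(x₀, trace) ≤ r] · ε₀² ≤ C · P_δ[dist(x₀, trace) ≤ ε₀] · r²` — the
critical SAW approaches a flat wall point within `r` no more often than `(r/ε₀)²` relative to the reference radius
(boundary two-leg exponent `≥ 2`; the first conjunct, verbatim, of the registered `stub_latticeAreaLaw`, hence implied by
it: `latticeAreaUpperBound_of_latticeAreaLaw`). In the restriction reshape this is the ONLY lattice exponent input: it
excludes `κ > 8/3` (S5⁺, S6⁺); `κ < 8/3` is excluded by restriction (RS2–RS5). Necessary for the crux (it follows from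
`SAWScalingLimit` exactly as S4 does, p130318). Open: an RSW-type one-sided estimate for the `x_c`-SAW of `ℤ²`. -/
theorem stub_latticeAreaUpperBound :
    ∀ (D : DobrushinDomain) (a b : ℝ → Site 2), SAW.IsEndpointApprox D a b →
      ∀ (x₀ : ℂ) (ρ₀ : ℝ), 0 < ρ₀ →
        D.carrier ∩ Metric.ball x₀ ρ₀ = {z : ℂ | x₀.im < z.im} ∩ Metric.ball x₀ ρ₀ →
        x₀ ≠ D.pt 0 → x₀ ≠ D.pt 1 →
        ∃ C ε₀ : ℝ, 0 < C ∧ 0 < ε₀ ∧ ∀ r : ℝ, 0 < r → r ≤ ε₀ →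
          ∀ᶠ δ in 𝓝[>] (0 : ℝ),
            SAW.law D.carrier δ (a δ) (b δ) {γ | Metric.infDist x₀ γ.curve.range ≤ r} *
                ENNReal.ofReal (ε₀ ^ 2) ≤
              ENNReal.ofReal C *
                SAW.law D.carrier δ (a δ) (b δ) {γ | Metric.infDist x₀ γ.curve.range ≤ ε₀} *
                  ENNReal.ofReal (r ^ 2) := by
  sorry

/-- S4⁺ is the first conjunct of S4: a proof of the registered two-sided law closes it. [folklore] -/
theorem latticeAreaUpperBound_of_latticeAreaLaw
    (h₄ : ∀ (D : DobrushinDomain) (a b : ℝ → Site 2), SAW.IsEndpointApprox D a b →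
      ∀ (x₀ : ℂ) (ρ₀ : ℝ), 0 < ρ₀ →
        D.carrier ∩ Metric.ball x₀ ρ₀ = {z : ℂ | x₀.im < z.im} ∩ Metric.ball x₀ ρ₀ →
        x₀ ≠ D.pt 0 → x₀ ≠ D.pt 1 →
        ∃ C ε₀ : ℝ, 0 < C ∧ 0 < ε₀ ∧ ∀ r : ℝ, 0 < r → r ≤ ε₀ →
          ∀ᶠ δ in 𝓝[>] (0 : ℝ),
            SAW.law D.carrier δ (a δ) (b δ) {γ | Metric.infDist x₀ γ.curve.range ≤ r} *
                ENNReal.ofReal (ε₀ ^ 2) ≤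
              ENNReal.ofReal C *
                SAW.law D.carrier δ (a δ) (b δ) {γ | Metric.infDist x₀ γ.curve.range ≤ ε₀} *
                  ENNReal.ofReal (r ^ 2) ∧
            SAW.law D.carrier δ (a δ) (b δ) {γ | Metric.infDist x₀ γ.curve.range ≤ ε₀} *
                ENNReal.ofReal (r ^ 2) ≤
              ENNReal.ofReal C *
                SAW.law D.carrier δ (a δ) (b δ) {γ | Metric.infDist x₀ γ.curve.range ≤ r} *
                  ENNReal.ofReal (ε₀ ^ 2)) :
    ∀ (D : DobrushinDomain) (a b : ℝ → Site 2), SAW.IsEndpointApprox D a b →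
      ∀ (x₀ : ℂ) (ρ₀ : ℝ), 0 < ρ₀ →
        D.carrier ∩ Metric.ball x₀ ρ₀ = {z : ℂ | x₀.im < z.im} ∩ Metric.ball x₀ ρ₀ →
        x₀ ≠ D.pt 0 → x₀ ≠ D.pt 1 →
        ∃ C ε₀ : ℝ, 0 < C ∧ 0 < ε₀ ∧ ∀ r : ℝ, 0 < r → r ≤ ε₀ →
          ∀ᶠ δ in 𝓝[>] (0 : ℝ),
            SAW.law D.carrier δ (a δ) (b δ) {γ | Metric.infDist x₀ γ.curve.range ≤ r} *
                ENNReal.ofReal (ε₀ ^ 2) ≤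
              ENNReal.ofReal C *
                SAW.law D.carrier δ (a δ) (b δ) {γ | Metric.infDist x₀ γ.curve.range ≤ ε₀} *
                  ENNReal.ofReal (r ^ 2) := by
  intro D a b hab x₀ ρ₀ hρ₀ hwin hx0 hx1
  obtain ⟨C, ε₀, hC, hε₀, h⟩ := h₄ D a b hab x₀ ρ₀ hρ₀ hwin hx0 hx1
  exact ⟨C, ε₀, hC, hε₀, fun r hr hrε => (h r hr hrε).mono fun δ hδ => hδ.1⟩

/-- **S5⁺ — UPPER AREA BOUND OF THE LIMIT (one-sided limit passage; provable now, M).** If the pushed SAW laws converge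
weakly to a probability measure `μ` along `s → 0⁺` and the lattice rarity bound S4⁺ holds along the sequence, then
`μ[dist(x₀, trace) < r] ≤ C' r²` for `0 < r < r₀` (portmanteau on the open event, `P_n(≤ ε₀) ≤ 1`; the upper half,
verbatim, of the landed S5 `stub_areaLawOfLimit` p96448 — no non-degeneracy needed). [folklore] -/
theorem stub_areaUpperOfLimit :
    ∀ (D : DobrushinDomain) (a b : ℝ → Site 2) (s : ℕ → ℝ) (μ : Measure (CurveClass ℂ)) (x₀ : ℂ),
      Tendsto s atTop (𝓝[>] (0 : ℝ)) → IsProbabilityMeasure μ →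
      (∀ f : CurveClass ℂ →ᵇ ℝ,
        Tendsto (fun n => ∫ γ, f γ.curve ∂(SAW.law D.carrier (s n) (a (s n)) (b (s n))))
          atTop (𝓝 (∫ x, f x ∂μ))) →
      (∃ C ε₀ : ℝ, 0 < C ∧ 0 < ε₀ ∧ ∀ r : ℝ, 0 < r → r ≤ ε₀ → ∀ᶠ n in atTop,
          SAW.law D.carrier (s n) (a (s n)) (b (s n)) {γ | Metric.infDist x₀ γ.curve.range ≤ r} *
                ENNReal.ofReal (ε₀ ^ 2) ≤
              ENNReal.ofReal C *
                SAW.law D.carrier (s n) (a (s n)) (b (s n))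
                    {γ | Metric.infDist x₀ γ.curve.range ≤ ε₀} *
                  ENNReal.ofReal (r ^ 2)) →
      ∃ C r₀ : ℝ, 0 < r₀ ∧ ∀ r ∈ Set.Ioo (0 : ℝ) r₀,
        μ {γ | Metric.infDist x₀ γ.range < r} ≤ ENNReal.ofReal (C * r ^ 2) :=
  _root_.Summit.CriticalPhenomena.SAWScalingLimit.Theorems.SubseqIdentification.BoundaryAreaLaw.stub_areaUpperOfLimit

/-- **S6⁺ — THE ONE-SIDED κ-PIN: an upper area bound at a flat window forces `κ ≤ 8/3` (known SLE theory, every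
ingredient PROVED in the tree; provable now, M — the `κ ≤ 8/3` half, verbatim, of the landed S6a/S6b/S6c
p96666/p96955/p96964).** If `μ` is the chordal SLE_κ law (`κ > 0`) of a Dobrushin domain with a flat horizontal window at
`x₀ ∉ {a, b}` and `μ[dist(x₀, trace) < r] ≤ C r²` for all small `r`, then `κ ≤ 8/3`: transport to the half-plane at the real
point `u₀ = Φ⁻¹(x₀) ≠ 0` (S6b), then Beffara's interior one-point LOWER estimate `measure_infDist_sleTrace_le_ge` gives
`A ρ^{8/κ−1} ≤ C' ρ²` for small `ρ`, so `8/κ − 1 ≥ 2` when `κ < 8`, and for `κ ≥ 8` the space-filling trace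
(`ae_isSpaceFilling_sleTrace_of_hasSLETrace_apply`) gives `1 ≤ C' ρ²`, absurd. [cite: Beffara2008, Prop. 4] -/
theorem stub_kappaLeOfUpper :
    ∀ (κ : ℝ≥0) (D : DobrushinDomain) (μ : Measure (CurveClass ℂ)) (x₀ : ℂ) (ρ₀ : ℝ),
      0 < κ → IsSLELaw κ D μ → 0 < ρ₀ →
      D.carrier ∩ Metric.ball x₀ ρ₀ = {z : ℂ | x₀.im < z.im} ∩ Metric.ball x₀ ρ₀ →
      x₀ ≠ D.pt 0 → x₀ ≠ D.pt 1 →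
      (∃ C r₀ : ℝ, 0 < r₀ ∧ ∀ r ∈ Set.Ioo (0 : ℝ) r₀,
          μ {γ | Metric.infDist x₀ γ.range < r} ≤ ENNReal.ofReal (C * r ^ 2)) →
      κ ≤ 8 / 3 :=
  _root_.Summit.CriticalPhenomena.SAWScalingLimit.Theorems.SubseqIdentification.BoundaryAreaLaw.stub_kappaLeOfUpper

/-- **RS2a — THE CARVED SUB-DOMAIN (planar topology; provable now, M/L).** If the Dobrushin domain `(D; a, b)` has a
flat horizontal window `D ∩ B(x₀, ρ₀) = {Im z > Im x₀} ∩ B(x₀, ρ₀)` whose closed ball misses the marked points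
(`ρ₀ ≤ dist(x₀, a)`, `ρ₀ ≤ dist(x₀, b)`), then for `0 < r < ρ₀` the carved set `D ∖ B̄(x₀, r)` is the carrier of a
Dobrushin domain with the same marked points: its boundary is the Jordan curve obtained from `∂D` by replacing the wall
segment `(x₀ − r, x₀ + r)` with the upper half of the circle `|z − x₀| = r` (inside the window, membership in `D`,
`closure D`, `frontier D` is read off the imaginary part: `window_mem_iff` of the landed S6b file); the carrier is open,
bounded and connected (re-route through the half-annulus `r < |z − x₀| < ρ₀`). Tree patterns: the carving lemmas of
`Theorems/SAWLoopFugacityFlowAvoidancePassage{Carving,Finite,Sandwich}.lean` (charted half-discs carved off a Jordan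
domain, re-marking), `ArcHullDomains.exists_isHullSubdomain_of_isArcHull`, `JordanCurveTheorem_holds`. [folklore] -/
theorem stub_halfBallSubdomain :
    ∀ (D : DobrushinDomain) (x₀ : ℂ) (ρ₀ r : ℝ), 0 < r → r < ρ₀ →
      D.carrier ∩ Metric.ball x₀ ρ₀ = {z : ℂ | x₀.im < z.im} ∩ Metric.ball x₀ ρ₀ →
      ρ₀ ≤ dist x₀ (D.pt 0) → ρ₀ ≤ dist x₀ (D.pt 1) →
      ∃ D' : DobrushinDomain,
        D'.carrier = D.carrier \ Metric.closedBall x₀ r ∧ D'.pt 0 = D.pt 0 ∧ D'.pt 1 = D.pt 1 :=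
  _root_.Summit.CriticalPhenomena.SAWScalingLimit.Theorems.SubseqIdentification.BoundaryAreaLaw.stub_halfBallSubdomain

/-- **RS2b — LATTICE NESTING OF THE CARVED SUB-DOMAIN AND THE SANDWICH OF THE CONFINEMENT EVENT (lattice geometry;
provable now, L).** In the setting of RS2a with `4 r ≤ ρ₀` and an endpoint approximation `(a_δ, b_δ)` of `D`, let `D'` be
a Dobrushin domain with carrier `D ∖ B̄(x₀, r)` and the same marked points. Then (i) `(a_δ, b_δ)` is an endpoint
approximation of `D'` as well, and for all small `δ > 0`: (ii) NESTING — every self-avoiding walk of `D'_δ` from `a_δ`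
to `b_δ` is, with the same support, a walk of `D_δ` (mesh vertices and closed edges are monotone in the domain; the
largest component of `D'_δ` is a single component containing the bulk, `JordanDomain.exists_forall_mem_meshDomain_and_reachable`,
and it is joined inside the mesh graph of `D` to the bulk of `D_δ`, hence lies in `meshDomain D δ`); (iii) every walk
of `D_δ` whose polyline stays at distance `> r` from `x₀` IS a walk of `D'_δ` (its vertices lie in `D ∖ B̄`, its closed
edges in `closure D ∖ B̄(x₀, r) ⊆ closure D'`, and it is joined to `a_δ ∈ meshDomain D' δ`); (iv) conversely the
polyline of a walk of `D'_δ` stays at distance `≥ r` from `x₀` (closed edges lie in `closure D' ⊆ ℂ ∖ B(x₀, r)`).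
For (i): a `D_δ`-path from `a_δ` that enters `B̄(x₀, r + 2δ)` is re-routed inside the window — from its last vertex
before entry go straight up (the distance to `x₀` increases) to height `ρ₀/2`, a point of the bulk of `D'` — so `a_δ`,
`b_δ` lie in the (single) largest component of `D'_δ`; mesh points `→ a, b` unchanged. [folklore] -/
theorem stub_halfBallNesting :
    ∀ (D D' : DobrushinDomain) (a b : ℝ → Site 2) (x₀ : ℂ) (ρ₀ r : ℝ),
      SAW.IsEndpointApprox D a b → 0 < r → 4 * r ≤ ρ₀ →
      D.carrier ∩ Metric.ball x₀ ρ₀ = {z : ℂ | x₀.im < z.im} ∩ Metric.ball x₀ ρ₀ →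
      ρ₀ ≤ dist x₀ (D.pt 0) → ρ₀ ≤ dist x₀ (D.pt 1) →
      D'.carrier = D.carrier \ Metric.closedBall x₀ r → D'.pt 0 = D.pt 0 → D'.pt 1 = D.pt 1 →
      SAW.IsEndpointApprox D' a b ∧
        ∀ᶠ δ in 𝓝[>] (0 : ℝ),
          (∀ γ' : SAW.DomainSAW D'.carrier δ (a δ) (b δ),
              ∃ γ : SAW.DomainSAW D.carrier δ (a δ) (b δ), γ.walk.support = γ'.walk.support) ∧
          (∀ γ : SAW.DomainSAW D.carrier δ (a δ) (b δ), r < Metric.infDist x₀ γ.curve.range →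
              ∃ γ' : SAW.DomainSAW D'.carrier δ (a δ) (b δ), γ'.walk.support = γ.walk.support) ∧
          (∀ γ : SAW.DomainSAW D.carrier δ (a δ) (b δ),
              (∃ γ' : SAW.DomainSAW D'.carrier δ (a δ) (b δ), γ'.walk.support = γ.walk.support) →
              r ≤ Metric.infDist x₀ γ.curve.range) :=
  _root_.Summit.CriticalPhenomena.SAWScalingLimit.Theorems.SubseqIdentification.BoundaryAreaLaw.stub_halfBallNesting

/-- **RS3 — RESTRICTION PASSES TO SUBSEQUENTIAL LIMITS (portmanteau; provable now, L; NO SLE input).** Let the pushed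
critical SAW laws of two discrete domains `Ω_δ ⊇ Ω'_δ` with common endpoints converge weakly along `s → 0⁺` to
probability measures `μ`, `μ'`, and suppose that eventually along the sequence (a) every `Ω'`-walk is, with the same
support, an `Ω`-walk (nesting), (b) every `Ω`-walk whose polyline stays at distance `> r` from `x₀` is an `Ω'`-walk and
(c) every `Ω'`-walk's polyline stays at distance `≥ r` from `x₀`. If `r` is not an atom of `dist(x₀, trace)` under `μ`,
then `μ' (T) · μ(N_r) = μ(T ∩ N_r)` for every measurable `T`, `N_r = {dist(x₀, trace) ≥ r}` — the two-sided restriction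
identity of LSW03/LSW04 for the pair. Proof: on the lattice, the confined law is EXACTLY `P_Ω(Conf) · P_{Ω'}` (the
support bijection preserves `x_c^{|γ|}` and the polyline: `SAW.weight_setOf_exists_support_eq_eq`,
`DomainSAW.toCurve_eq_of_support_eq`, `law_setOf_exists_support_eq_eq`), so the finite measures
`ν_n = P_Ω(· ∩ Conf) ∘ curve⁻¹` equal `P_Ω(Conf) · (P_{Ω'} ∘ curve⁻¹)`; by (b)/(c) they are sandwiched between the
restrictions of `P_Ω ∘ curve⁻¹` to the open set `{dist > r}` and to the closed set `{dist ≥ r}`; portmanteau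
(`le_liminf_measure_open_of_tendsto`, `limsup_measure_closed_le_of_tendsto`, for nonnegative bounded continuous test
functions via the layer-cake / or directly on sets with `μ(∂) = 0`, `tendsto_measure_of_null_frontier`) gives
`P_Ω(Conf) → μ(N_r)` and `∫ f dν_n → ∫_{N_r} f dμ`; hence `μ(N_r) · μ' = μ|_{N_r}` as finite measures (uniqueness of weak
limits, `ext_of_forall_integral_eq_of_IsFiniteMeasure`). [cite: LawlerSchrammWerner2004SAW, §3.4.5] -/
theorem stub_restrictionPassage :
    ∀ (Ω Ω' : Set ℂ) (a b : ℝ → Site 2) (s : ℕ → ℝ) (μ μ' : Measure (CurveClass ℂ)) (x₀ : ℂ) (r : ℝ),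
      Tendsto s atTop (𝓝[>] (0 : ℝ)) → IsProbabilityMeasure μ → IsProbabilityMeasure μ' →
      (∀ f : CurveClass ℂ →ᵇ ℝ,
        Tendsto (fun n => ∫ γ, f γ.curve ∂(SAW.law Ω (s n) (a (s n)) (b (s n))))
          atTop (𝓝 (∫ x, f x ∂μ))) →
      (∀ f : CurveClass ℂ →ᵇ ℝ,
        Tendsto (fun n => ∫ γ, f γ.curve ∂(SAW.law Ω' (s n) (a (s n)) (b (s n))))
          atTop (𝓝 (∫ x, f x ∂μ'))) →
      (∀ᶠ n in atTop,
          (∀ γ' : SAW.DomainSAW Ω' (s n) (a (s n)) (b (s n)),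
              ∃ γ : SAW.DomainSAW Ω (s n) (a (s n)) (b (s n)), γ.walk.support = γ'.walk.support) ∧
          (∀ γ : SAW.DomainSAW Ω (s n) (a (s n)) (b (s n)), r < Metric.infDist x₀ γ.curve.range →
              ∃ γ' : SAW.DomainSAW Ω' (s n) (a (s n)) (b (s n)), γ'.walk.support = γ.walk.support) ∧
          (∀ γ : SAW.DomainSAW Ω (s n) (a (s n)) (b (s n)),
              (∃ γ' : SAW.DomainSAW Ω' (s n) (a (s n)) (b (s n)), γ'.walk.support = γ.walk.support) →
              r ≤ Metric.infDist x₀ γ.curve.range)) →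
      μ {c | Metric.infDist x₀ c.range = r} = 0 →
      ∀ T : Set (CurveClass ℂ), MeasurableSet T →
        μ' T * μ {c | r ≤ Metric.infDist x₀ c.range} = μ (T ∩ {c | r ≤ Metric.infDist x₀ c.range}) :=
  _root_.Summit.CriticalPhenomena.SAWScalingLimit.Theorems.SubseqIdentification.BoundaryAreaLaw.stub_restrictionPassage

/-! ### RS5 — SLE-SIDE RESTRICTION RIGIDITY BELOW 8/3 (known SLE theory; the SLE debt of this sub-line), decomposed r-c4-3 into RS5a/RS5b/RS5c

(Reshape r-c4-2 after the wave-1 audit `RS5-AUDIT.md`: the registered `stub_sleRestrictionRigidity` (range `0 < κ ≤ 4`, `κ ≠ 8/3`)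
is NARROWED to `0 < κ < 8/3`, the only range the composition consumes (S6⁺ gives `κ ≤ 8/3`) and the only range where the
tree has LSW03 Prop. 5.3 / Thm. 6.5 (`exists_isRestrictionMartingaleK`, `thm65_printed`, PROVED) and positivity of avoidance
(`sleAvoidance_pos`, p134575); the identity HOLDS at `κ = 8/3` (`sleRestrictionConsistency_eightThirds`, p134385) and transports to
the canonical space (`sleRestriction_canonical_of_identity`, p134861). Residual = (G) the Girsanov/boundary-perturbation reading of
Prop. 5.3 (`thm65_tilted`, printed SLE theory, XL) + (ND) non-degeneracy of the compensator on avoidance events (L).)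
Among the chordal SLE_κ laws with `0 < κ ≤ 4` only `κ = 8/3` satisfies the domain-restriction identity at a flat-window
half-ball: if `κ ≠ 8/3`, `(D; a, b)` has a flat horizontal window at `x₀` whose closed ball misses `a, b`, `D'` is the
carved domain `D ∖ B̄(x₀, r)` (`0 < r < ρ₀`) with the same marked points, `μ = SLE_κ(D)` and `μ' = SLE_κ(D')`, then
`μ'(T) · μ(N_r) = μ(T ∩ N_r)` FAILS for some measurable `T` (`N_r = {dist(x₀, trace) ≥ r}`). Source: Lawler–Schramm–Werner,
*Conformal restriction: the chordal case* (2003), Prop. 5.3 and Thm. 6.5 — transported to `ℍ` by a uniformizer, the law of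
`Φ_A⁻¹(SLE_κ)` (SLE_κ in `ℍ ∖ A`, `A` the pulled-back hull) has density `1_{γ ∩ A = ∅} exp(λ ∫₀^∞ Sh_s(W_s)/6 ds) / Φ_A'(0)^α`
against SLE_κ in `ℍ` (`α = (6 − κ)/(2κ)`, `λ = (8 − 3κ)(6 − κ)/(2κ)`), whereas the identity says the density is
`1_{γ ∩ A = ∅} / P[γ ∩ A = ∅]`; for `λ ≠ 0` (i.e. `κ ∉ {8/3, 6}`) the compensator is a non-degenerate random variable on
`{γ ∩ A = ∅}`, contradiction; `P[γ ∩ A = ∅] > 0` because `κ ≤ 4` (simple trace off the boundary). LSW04 §2.1 p. 7: "for any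
other `κ ≤ 4`, the probability of staying in `ℍ ∖ A` is not given by `Φ_A'(0)^α`" (tree: named fact
`sle_restrictionFormula_only_eightThirds`; general-κ Thm 6.5 skeleton `SLERestrictionMartingaleKappa*`; the κ = 8/3 direction
`IsSLELaw.hullRestriction_eightThirds_holds` is PROVED). In this line it is consumed only for `κ < 8/3` (S6⁺ gives `κ ≤ 8/3`).
[cite: LawlerSchrammWerner2003Restriction, Prop. 5.3; Thm. 6.5] [cite: LawlerSchrammWerner2004SAW, §2.1 p. 7] -/
/-- **RS5a — HULL FORM OF THE IDENTITY (bookkeeping; provable now, M).** For `0 < κ ≤ 4`, the restriction identity between the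
SLE_κ laws of `(D, D ∖ B̄(x₀, r))` at a flat window transports to the canonical space: with `A ∈ 𝒬*` the pull-back of the carved
half-ball along the uniformizer `φ` of the `IsSLELaw κ D μ` witness (`φ.pullbackHull D'`, nonempty) and `Φ = Φ_A` its restriction map,
the SLE_κ trace `γ` in `ℍ` satisfies `P[γ ∩ A = ∅, Φ_A(γ(0,∞)) ∩ B = ∅] = P[γ ∩ A = ∅] · P[γ ∩ B = ∅]` for EVERY `B ∈ 𝒬*` (the law
of `Φ_A(γ)` given `{γ ∩ A = ∅}` is SLE_κ, tested on hull avoidance). First half landed as `sleRestriction_canonical_of_identity`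
(p134861: `μ'(T)·P[E_A] = P(E_A ∩ Γ⁻¹T)`); remaining: `μ' = law of (φ ∘ Φ_A⁻¹)(γ)` by uniqueness in law (`IsSLECurve.map_eq_holds`,
`IsChordalUniformizing.pullback`) and the event dictionary `Γ⁻¹{c ∩ φ(Φ_A⁻¹(B ∩ ℍ)) = ∅} ∩ E_A = E_A ∩ {Φ_A(γ(t)) ∉ B, t > 0}`
(simple trace in `ℍ ∪ {0}` for `κ ≤ 4`: `ae_isSimpleTrace_sleTrace_of_le_four_holds`, `SLERealAvoidance`); verbatim the second
half of `IsSLELaw.hullRestriction_eightThirds_of_sle_restriction` (`SLERestrictionLocal.lean` l.572–805) run backwards.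
[cite: LawlerSchrammWerner2003Restriction, §2 p. 9; Prop. 3.3 (1)] -/
theorem stub_sleAvoidProductOfIdentity :
    ∀ (κ : ℝ≥0), 0 < κ → κ ≤ 4 →
      ∀ (D D' : DobrushinDomain) (μ μ' : Measure (CurveClass ℂ)) (x₀ : ℂ) (ρ₀ r : ℝ),
        0 < r → r < ρ₀ →
        D.carrier ∩ Metric.ball x₀ ρ₀ = {z : ℂ | x₀.im < z.im} ∩ Metric.ball x₀ ρ₀ →
        ρ₀ ≤ dist x₀ (D.pt 0) → ρ₀ ≤ dist x₀ (D.pt 1) →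
        D'.carrier = D.carrier \ Metric.closedBall x₀ r → D'.pt 0 = D.pt 0 → D'.pt 1 = D.pt 1 →
        IsSLELaw κ D μ → IsSLELaw κ D' μ' →
        (∀ T : Set (CurveClass ℂ), MeasurableSet T →
            μ' T * μ {c | r ≤ Metric.infDist x₀ c.range} = μ (T ∩ {c | r ≤ Metric.infDist x₀ c.range})) →
        ∃ (A : Set ℂ) (Φ : ConformalEquiv (upperHalfPlaneSet \ A) upperHalfPlaneSet),
          IsStarHull A ∧ A.Nonempty ∧ IsRestrictionMap A Φ ∧
            ∀ (B : Set ℂ), IsStarHull B →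
              preWienerMeasure {ω | Disjoint (range (sleTrace κ ω)) A ∧ ∀ t, 0 < t → Φ (sleTrace κ ω t) ∉ B} =
                preWienerMeasure {ω | Disjoint (range (sleTrace κ ω)) A} *
                  preWienerMeasure {ω | Disjoint (range (sleTrace κ ω)) B} :=
  _root_.Summit.CriticalPhenomena.SAWScalingLimit.Theorems.SubseqIdentification.BoundaryAreaLaw.stub_sleAvoidProductOfIdentity

/-- **RS5b″Π — THE PRODUCT IDENTITY FOR THE LOCALISED MARTINGALES (LANDED p145819, wave 4; reshape r-c4-5; LSW03 (5.1)–(5.3) + Prop. 5.3; M/L).**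
For `0 < κ ≤ 8/3`, `α = (6−κ)/(2κ)`, `λ = (8−3κ)(6−κ)/(2κ)`, a nonempty `A ∈ 𝒬*` and levels `n ≤ k`: the product `Mⁿ · Lᵏ` of the
localised image driver `Mⁿ = imgMartK κ hA hne n` (`h_t(W_t)` stopped at `imgLocTimeK n ≤ locTimeK n ≤ locTimeK k`) with the localised
compensated restriction martingale `Lᵏ = locMartK κ α λ hA hne k` (a bounded martingale, `martingale_locMartK`) is a martingale of the
Brownian filtration. CELL SCHEME (no stochastic calculus): on a cell `[u, u+h]`, `Δ(M L) = M_u ΔL + ΔM · L_{u+h}`; the first summand has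
conditional mean EXACTLY zero (`L` martingale, `M_u` bounded `𝓕_u`-measurable); in the second `ΔM ≠ 0` only if `u < imgLocTimeK n`, and
then (interior cells) `L_{u+h} = e^{−λ Iᵏ_u} · Ŷ′` with the frozen one-step first moment `E_{ω₂}[ΔW̃ · Ŷ′] = h d^α c₂ (κ/2 − 3 + κα) + O(h√h)
= O(h√h)` (`frozen_prod_integral_sub_le`, p140980, with `(α′, λ′) = (α, λ)`: THE CANCELLATION `κα + κ/2 − 3 = 0`); boundary cells
`{u < imgLocTimeK n < u + h}` by the small-oscillation event as in `SLEImageMartingale` / `SLERestrictionLocalMartingaleKappa`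
(`abs_setIntegral_cell_leK`, `abs_setIntegral_sub_le_of_partitionK`, `setIntegral_locMartK_sub_eq_zero` are the templates).
[cite: LawlerSchrammWerner2003Restriction, §5 (5.1)–(5.3); Prop. 5.3] -/
theorem stub_tiltedProductMartingale :
    ∀ (κ : ℝ≥0) (α lam : ℝ), 0 < κ → κ ≤ 8 / 3 → α = (6 - κ) / (2 * κ) →
      lam = (8 - 3 * κ) * (6 - κ) / (2 * κ) → ∀ (A : Set ℂ) (hA : IsStarHull A) (hne : A.Nonempty) (n k : ℕ), n ≤ k →
      Martingale (fun t ω => imgMartK κ hA hne n t ω * locMartK κ α lam hA hne k t ω) brownianFiltration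
        preWienerMeasure :=
  _root_.Summit.CriticalPhenomena.SAWScalingLimit.Theorems.SubseqIdentification.BoundaryAreaLaw.stub_tiltedProductMartingale

/-- **RS5b″Σ — THE BRACKET IDENTITY FOR THE LOCALISED MARTINGALES (LANDED p149421, wave 4; reshape r-c4-5; LSW03 (5.1)–(5.3) + Prop. 5.3; M/L).**
Same setting: `((Mⁿ)² − κ Cⁿ) · Lᵏ` is a martingale (`Cⁿ = imgClockK κ hA hne n = ∫ h_t′(W_t)² dt` stopped). CELL SCHEME: on `[u, u+h]`,
`Δ((M² − κC) L) = (M² − κC)_u ΔL + (2 M_u ΔM + (ΔM)² − κ ΔC) · L_{u+h}`; first summand exactly mean zero; `2M_u · E[ΔM · Ŷ′] = O(h√h)`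
(first frozen moment, cancellation as in Π); `E[(ΔM)² Ŷ′] = κ d² d^α h + O(h√h)` (second frozen moment `frozen_prod_sq_integral_sub_le`
with `(α′, λ′) = (α/2, λ/2)`, since `Ŷ′_{α/2,λ/2}² = Ŷ′_{α,λ}`); `E[κ ΔC · Ŷ′] = κ d² d^α h + O(h√h)` (clock increment `ΔC = d² h + O(hη)` on the
good event, `SLEImageBracketCell`, times `Ŷ′ = d^α + O(|x| + h)`); the two `κ d² d^α h` cancel. Boundary cells as in Π; templates
`SLEImageBracketCell/Estimate/Martingale`. [cite: LawlerSchrammWerner2003Restriction, §5 (5.1)–(5.3); Prop. 5.3] -/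
theorem stub_tiltedBracketMartingale :
    ∀ (κ : ℝ≥0) (α lam : ℝ), 0 < κ → κ ≤ 8 / 3 → α = (6 - κ) / (2 * κ) →
      lam = (8 - 3 * κ) * (6 - κ) / (2 * κ) → ∀ (A : Set ℂ) (hA : IsStarHull A) (hne : A.Nonempty) (n k : ℕ), n ≤ k →
      Martingale (fun t ω => (imgMartK κ hA hne n t ω ^ 2 - κ * imgClockK κ hA hne n t ω) *
        locMartK κ α lam hA hne k t ω) brownianFiltration preWienerMeasure :=
  _root_.Summit.CriticalPhenomena.SAWScalingLimit.Theorems.SubseqIdentification.BoundaryAreaLaw.stub_tiltedBracketMartingale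

/-- **RS5b′ — THE TILTED MARTINGALES (LSW03 (5.1)–(5.3) + Prop. 5.3), DERIVED r-c4-5 from Π and Σ by the landed glue
`stub_tiltedMartingales_of_products` (p141314: `Y = Ȳ = YbarK … k₀`, the bounded martingale of Prop. 5.3, is at every time the a.s. limit of
`Lᵏ`, `ae_tendsto_locMartK_YbarK`; bounded limits of martingales are martingales, `martingale_of_tendsto_of_abs_le`).**
(Registered r-c4-4 as the ONE remaining analytic step of RS5b after wave 2.) For `0 < κ ≤ 8/3` and a nonempty `A ∈ 𝒬*` there is a compensated restriction martingale `Y` (spec `IsRestrictionMartingaleK`, the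
tree's `YbarK`, `exists_isRestrictionMartingaleK`) such that, at every localisation level `n`, the products of `Y` with the localised
image driving function `Mⁿ = imgMartK κ hA hne n` (`W̃ = h_t(W_t)` stopped) and with `(Mⁿ)² − κ·imgClockK` are martingales for the
Brownian filtration: the tilted drift of `W̃` is `(κα + κ/2 − 3) h'' = 0`. With it, `stub_thm65Tilted` follows by the landed assembly
`stub_thm65Tilted_of_tiltedMartingales` (p137601; chain p136390 T1/T7, p136401 T3, p136690 T5, p136807 T4, p137143 T6, p137314). Plan
and sub-steps (T2a pull-out, T2b one-step covariance estimate — the only new analysis —, T2c cell summation): `RS5b-PLAN.md` (item evidence).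
[cite: LawlerSchrammWerner2003Restriction, §5 (5.1)–(5.3); Prop. 5.3] -/
theorem stub_tiltedMartingales :
    ∀ (κ : ℝ≥0), 0 < κ → κ ≤ 8 / 3 → ∀ (A : Set ℂ) (hA : IsStarHull A) (hne : A.Nonempty),
      ∃ Y : ℝ≥0 → (ℝ≥0 → ℝ) → ℝ,
        IsRestrictionMartingaleK κ (sleBubbleExponent κ) (sleBubbleIntensityReal κ) A (LpK κ A) Y ∧
        ∀ n : ℕ, Martingale (fun t ω => imgMartK κ hA hne n t ω * Y t ω) brownianFiltration preWienerMeasure ∧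
          Martingale (fun t ω => (imgMartK κ hA hne n t ω ^ 2 - κ * imgClockK κ hA hne n t ω) * Y t ω)
            brownianFiltration preWienerMeasure :=
  _root_.Summit.CriticalPhenomena.SAWScalingLimit.Theorems.SubseqIdentification.BoundaryAreaLaw.stub_tiltedMartingales_of_products
    stub_tiltedProductMartingale stub_tiltedBracketMartingale

/-- **RS5b — THE TILTED THEOREM 6.5 / BOUNDARY PERTURBATION OF SLE_κ (printed SLE theory, NOT yet formalised; XL).** For
`0 < κ ≤ 8/3`, `A, B ∈ 𝒬*`, `Φ_A` the restriction map, `d = Φ_A'(0)`, `α = sleBubbleExponent κ = (6 − κ)/(2κ)`,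
`λ = sleBubbleIntensity κ = (8 − 3κ)(6 − κ)/(2κ)`, `X_A = exp(−λ ∫₀^∞ m(A_t − W_t) dt)` (`m = starBubbleMass`):
`E[1{γ ∩ A = ∅, Φ_A(γ(0,∞)) ∩ B = ∅} · X_A] = Φ_A'(0)^α · P[γ ∩ B = ∅]` — i.e. under the probability `(1_{E_A} X_A / Φ_A'(0)^α)·P`
the curve `Φ_A(γ)` IS an SLE_κ (tested on hull avoidance, which determines the law, LSW Lemma 3.2). `B = ∅` is the tree's PROVED
`thm65_printed` (LSW03 Thm. 6.5); `κ = 8/3` (λ = 0) is `sle_restriction_eightThirds.measure_avoid_and_comp_avoid`. Proof in print: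
LSW03 §5 (5.1)–(5.3) (`W̃_t = h_t(W_t)`, `dW̃ = h_t'(W_t) dW_t + (κ/2 − 3) h_t''(W_t) dt`) and Prop. 5.3
(`dY_t = Y_t α √κ (h''/h')(W_t) dB_t`; Lawler 2005 (6.10), Prop. 6.19): under `(Y_∞/Y_0)·P` (Girsanov), `W` acquires the drift
`κα h''/h'`, the drift of `W̃` becomes `(κα + κ/2 − 3) h'' = 0`, so `W̃` time-changed by `∫ h_s'(W_s)² ds` is `√κ B` (Lévy) and `Φ_A(γ)` is
SLE_κ; `Y_∞ = 1_{E_A} X_A` by the proof of Thm. 6.5. Law-level form ("boundary perturbation", `dμ_{ℍ∖A}/dμ_ℍ ∝ 1{γ ∩ A = ∅} e^{(c/2) m(γ, A)}`):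
Lawler, *Partition functions, loop measure, and versions of SLE*, J. Stat. Phys. 134 (2009). Tree support: `MartingaleProblemTilting`
(`martingale_expDensity`, tilted martingale problem — Girsanov for h-transforms without stochastic integrals), `SLEImage*`
(semimartingale decomposition of the image driver, done for κ = 6), `ConformalDDS`/`LevyCharacterisation`, `SLELawOfDrivingProcess`,
`exists_isRestrictionMartingaleK` (Prop. 5.3, PROVED for κ ≤ 8/3), `hullProduct`. [cite: LawlerSchrammWerner2003Restriction, Prop. 5.3; §5 (5.1)–(5.3); Thm. 6.5] -/
theorem stub_thm65Tilted :
    ∀ (κ : ℝ≥0), 0 < κ → κ ≤ 8 / 3 → ∀ (A B : Set ℂ), IsStarHull A → IsStarHull B →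
      ∀ (Φ : ConformalEquiv (upperHalfPlaneSet \ A) upperHalfPlaneSet), IsRestrictionMap A Φ →
        ∀ (d : ℝ), HasRestrictionDeriv A Φ d →
          ∫⁻ ω, {ω | Disjoint (range (sleTrace κ ω)) A ∧ ∀ t, 0 < t → Φ (sleTrace κ ω t) ∉ B}.indicator
              (fun ω => poissonAvoidance (sleBubbleIntensity κ *
                ∫⁻ t, ENNReal.ofReal (starBubbleMass (Loewner.slidHull (sleDriving κ ω) A t)) ∂timeMeasure)) ω
            ∂preWienerMeasure =
          ENNReal.ofReal (d ^ sleBubbleExponent κ) * preWienerMeasure {ω | Disjoint (range (sleTrace κ ω)) B} :=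
  _root_.Summit.CriticalPhenomena.SAWScalingLimit.Theorems.SubseqIdentification.BoundaryAreaLaw.stub_thm65Tilted_of_tiltedMartingales stub_tiltedMartingales

/-! ### RS5c RE-ROUTED (reshape r-c4-7, lead c4 cycle 2): law-level parts L1, L2 and the residual L3

The r-c4-3/4 decomposition RS5c := `compensatorNondegenerate_of_unbounded` ∘ UNB (`stub_compensatorUnbounded`, deterministic:
∀q ∃B, `L^A ≥ q` on `E_A ∩ F_B`) is RETIRED: UNB is true but its proof needs Beurling-type conformal-distance estimates at the tip
(absent from the tree); the heightDrop/cage route works only for needle-like hulls (interior leak of fat hulls) — see the lead's NOTES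
`## RS5c analysis`. The registered stubs `stub_compensatorUnbounded`, `stub_compensatorNondegenerate` remain on the ledger as superseded.
NEW (glue `stub_sleRestrictionRigidityBelow_of_lawParts`, LANDED p151364, sorry-free): RS5 ⇐ L1 ∧ L2 ∧ L3 with the contradiction
"restriction identity + tilted law identity + factorization ⇒ `X_A = exp(−λL^A)` a.s. CONSTANT on `E_A`" vs L3. -/

/-- **L1 — THE TILTED THEOREM 6.5 AT LAW LEVEL (LANDED p152723, wave 5; one 344-line file, via `CurveClass.Measure.ext_of_missCode_injOn` on the chordal carrier of D').** With `Γ` the SLE_κ curve of `D` through `φ`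
(`μ = P∘Γ⁻¹`), `A = φ.pullbackHull D'` the pulled-back carved half-ball, `Φ = Φ_A`, `Φ'(0) = d`, `E_A = {γ ∩ A = ∅}`,
`X_A = poissonAvoidance(λ_κ L^A)`: `∫_{E_A ∩ Γ⁻¹T} X_A dP = d^α · SLE_κ(D')(T)` for every measurable `T` — the finite measure
`(1_{E_A} X_A P)∘Γ⁻¹` IS `d^α·SLE_κ(D')`: total mass `d^α` (Thm 6.5, B = ∅), carried by simple chords of `D'`, and it agrees with
`d^α μ'` on the hull-subdomain events `rangeSubset (closure D'')` (= avoidance of the pulled-back hull `B''` by `Φ_A(γ)`, where the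
PROVED tilted Thm 6.5 `stub_thm65Tilted` gives `d^α P[γ ∩ B'' = ∅] = d^α μ'(rangeSubset cl D'')`); [LSW] Lemma 3.2 in `D'`
(`AvoidanceDeterminesLaw_proof`, PROVED) identifies the two. [cite: LawlerSchrammWerner2003Restriction, Thm. 6.5; Lemma 3.2] -/
theorem stub_tiltedLawIdentity :
    ∀ (κ : ℝ≥0), 0 < κ → κ ≤ 8 / 3 →
      ∀ (D D' : DobrushinDomain) (μ μ' : Measure (CurveClass ℂ)) (x₀ : ℂ) (ρ₀ r : ℝ),
        0 < r → r < ρ₀ →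
        D.carrier ∩ Metric.ball x₀ ρ₀ = {z : ℂ | x₀.im < z.im} ∩ Metric.ball x₀ ρ₀ →
        ρ₀ ≤ dist x₀ (D.pt 0) → ρ₀ ≤ dist x₀ (D.pt 1) →
        D'.carrier = D.carrier \ Metric.closedBall x₀ r → D'.pt 0 = D.pt 0 → D'.pt 1 = D.pt 1 →
        IsSLELaw κ D μ → IsSLELaw κ D' μ' →
        ∀ (Γ : (ℝ≥0 → ℝ) → CurveClass ℂ) (φ : ConformalEquiv upperHalfPlaneSet D.carrier),
          D.IsChordalUniformizing φ → AEMeasurable Γ preWienerMeasure →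
          (∀ᵐ ω ∂preWienerMeasure, Loewner.IsGeneratedByCurve (sleDriving κ ω) (sleTrace κ ω) ∧
              ∃ c : Curve ℂ, Γ ω = CurveClass.mk c ∧
                IsCompactifiedImage φ.boundaryExtension (sleTrace κ ω) (D.pt 1) c) →
          μ = preWienerMeasure.map Γ →
          ∀ (Φ : ConformalEquiv (upperHalfPlaneSet \ φ.pullbackHull D') upperHalfPlaneSet),
            IsRestrictionMap (φ.pullbackHull D') Φ →
            ∀ (d : ℝ), HasRestrictionDeriv (φ.pullbackHull D') Φ d →
            ∀ T : Set (CurveClass ℂ), MeasurableSet T →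
              ∫⁻ ω in {ω | Disjoint (range (sleTrace κ ω)) (φ.pullbackHull D')} ∩ Γ ⁻¹' T,
                  poissonAvoidance (sleBubbleIntensity κ *
                    ∫⁻ t, ENNReal.ofReal (starBubbleMass
                      (Loewner.slidHull (sleDriving κ ω) (φ.pullbackHull D') t)) ∂timeMeasure)
                ∂preWienerMeasure =
              ENNReal.ofReal (d ^ sleBubbleExponent κ) * μ' T :=
  _root_.Summit.CriticalPhenomena.SAWScalingLimit.Theorems.SubseqIdentification.BoundaryAreaLaw.stub_tiltedLawIdentity

/-- **L2 — THE COMPENSATOR WEIGHT FACTORS THROUGH THE CURVE CLASS ON THE AVOIDANCE EVENT (LANDED p153880, wave 5; the r-c4-7 form without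
`Disjoint (range (sleTrace κ ω)) A →` was `stub-misstated`: off the event the junk slid hull past the hitting time is not measurably controlled;
reshape r-c4-8 = this corrected signature + glue `…of_lawPartsAvoid` p154031).** `X_A(ω) = F(sleDriving κ ω)` and the
driving function of the described class `Γ ω` is `sleDriving κ ω` (`IsLoewnerDescribed.drivingFunction_eq`, uniqueness
`driving_unique_holds`), so `X_A = (F ∘ drivingFunction φ)(Γ ω)` with `drivingFunction φ` measurable (`measurable_drivingFunction`). [folklore] -/
theorem stub_compensatorFactorsOnAvoidance :
    ∀ (κ : ℝ≥0), 0 < κ → κ ≤ 4 → ∀ (D : DobrushinDomain) (φ : ConformalEquiv upperHalfPlaneSet D.carrier),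
      D.IsChordalUniformizing φ → ∀ (A : Set ℂ), IsStarHull A →
        ∃ G : CurveClass ℂ → ℝ≥0∞, Measurable G ∧
          ∀ (Γ : (ℝ≥0 → ℝ) → CurveClass ℂ), ∀ᵐ ω ∂preWienerMeasure,
            (Loewner.IsGeneratedByCurve (sleDriving κ ω) (sleTrace κ ω) ∧
              ∃ c : Curve ℂ, Γ ω = CurveClass.mk c ∧
                IsCompactifiedImage φ.boundaryExtension (sleTrace κ ω) (D.pt 1) c) →
            Disjoint (range (sleTrace κ ω)) A →
            poissonAvoidance (sleBubbleIntensity κ *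
                ∫⁻ t, ENNReal.ofReal (starBubbleMass (Loewner.slidHull (sleDriving κ ω) A t)) ∂timeMeasure) =
              G (Γ ω) :=
  _root_.Summit.CriticalPhenomena.SAWScalingLimit.Theorems.SubseqIdentification.BoundaryAreaLaw.compensatorFactorsThroughCurve_of_disjoint

/-! ### L3 RESHAPED (lead c5, 2026-08-17): the SUPPORT ROUTE by semicircle steering — L3 ⇐ L3a ∧ L3b ∧ L3c

No potential theory and no new slit-map asymptotics: aim at `A` along a SEMICIRCLE from `0` orthogonal to `ℝ` (the Möbius image
`N(iℝ₊)`, `N(z) = a + b/(p − z)`, `N(0) = 0`, of the imaginary axis; every `z₀ ∈ A ∩ ℍ` with `Re z₀ ≠ 0` lies on exactly one), or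
along the vertical ray when `A` meets `iℝ₊`. By `LoewnerMoebiusImageChain` (Lawler §4.6.1/§6.3, PROVED) the image of the zero-driver
chain (vertical slit, `g_u(z) = √(z²+4u)`, `isSolution_zeroDriver` p154772) is the chordal Loewner chain of the continuous driver
`imageDriver` (from `0`) in the explicit capacity clock, with `ĝ_{clock u} ∘ N = h_u ∘ g_u` (`map_imageDriver_apply`), `h_u` an explicit
real Möbius map; for the FIRST point `a = N(i y*)` of the semicircle in `A` the arc keeps `A` alive, the chart position of `a` is
`Ẑ = h_u(i√(y*²−4u)) − h_u(0)` (head-on), and the certified integrand `(Im Ẑ/|Ẑ|²)²/2` integrates in the image clock to exactly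
`(1/8) log(y*²/(y*²−4u)) → ∞` (the Möbius factors cancel) — c4's number for every hull (L3a). Robustness under a sup-norm driver
perturbation is the tree's Kemppainen–Smirnov Lemma 5.4 (`Loewner.exists_forall_dist_map_le_of_driving_close`, uniform on the compact
`A`, real points included) applied to the POINTWISE bound `m(B) ≥ (Im z/|z|²)²/2` (`starBubbleMass_ge_of_mem`) — L3b. The passage to
L3 (L3c) is: tube positivity (p154929) + the weak Markov property of the driver at the FIXED time `S` (Mathlib
`IsPreBrownianReal.indepFun_shift`) + the point/slid-hull cocycle + avoidance positivity of a `*`-hull (`thm65_printed` with `𝒫 ≤ 1`: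
`P(E_B) ≥ Φ_B'(0)^α > 0`) + `ae_disjoint_closedHull_iff_lt_firstHit`. -/

/-- **L3a-V — STEERING DATA, VERTICAL CASE (deterministic, M; c4's `…CompensatorVerticalSlit` p154772 minus the mass bound).** For
`A ∈ 𝒬*` whose lowest point on the imaginary axis is `i y₀` (`y₀ > 0`): for every `q` there is a time `S` (`4S < y₀²`) such that every
point of `A` (real points included) is still flowing at `S` under the zero driver, and the certified integrand of the point `i y₀`,
`(Im Z_s/|Z_s|²)²/2 = 1/(2(y₀² − 4s))` with `Z_s = g_s(i y₀) = i√(y₀² − 4s)` (`map_zeroDriver_I_mul`), has `∫_{(0,S]} ≥ q`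
(`= (1/8) log(y₀²/(y₀² − 4S))`). [cite: Lawler2005, Ch. 4 §4.1 (vertical slit)] -/
theorem stub_steeringVertical :
    ∀ (A : Set ℂ), IsStarHull A → ∀ (y₀ : ℝ), 0 < y₀ → Complex.I * y₀ ∈ A →
      (∀ y : ℝ, 0 < y → y < y₀ → Complex.I * y ∉ A) → ∀ (q : ℝ),
      ∃ S : ℝ≥0, (∀ z ∈ A, (S : WithTop ℝ≥0) < Loewner.swallowingTime (fun _ : ℝ≥0 => (0 : ℝ)) z) ∧
        ENNReal.ofReal q ≤ ∫⁻ s in Set.Ioc (0 : ℝ) S,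
          ENNReal.ofReal (((Loewner.map (fun _ : ℝ≥0 => (0 : ℝ)) s.toNNReal (Complex.I * y₀)).im /
            Complex.normSq (Loewner.map (fun _ : ℝ≥0 => (0 : ℝ)) s.toNNReal (Complex.I * y₀))) ^ 2 / 2) :=
  _root_.Summit.CriticalPhenomena.SAWScalingLimit.Theorems.SubseqIdentification.BoundaryAreaLaw.stub_steeringVertical

/-- **L3a-A — STEERING DATA, ARC CASE (deterministic, L/XL; the new manoeuvre).** For `A ∈ 𝒬*` and a point `z₀ ∈ A ∩ ℍ` off the
imaginary axis: for every `q` there are a continuous driver `U` from `0` (the `imageDriver` of the zero driver under the real Möbius map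
`N(z) = a + b/(p − z)`, `b > 0`, `N(0) = 0`, carrying `iℝ₊` onto the semicircle through `0` and `z₀` orthogonal to `ℝ`), a time `S`
and a point `a ∈ A ∩ ℍ` (the FIRST point of the semicircle in `A`) such that every point of `A` is still flowing at `S` under `U`
(`domain_imageDriver_eq` / `hull_imageDriver_eq`: the hull is the arc below `a`; real points by
`Loewner.lt_swallowingTime_of_notMem_closure_hull_holds`) and the certified integrand of `a` along `U` has `∫_{(0,S]} ≥ q`
(`ĝ_{clock u}(a) − U = h_u(i√(y*²−4u)) − h_u(0)`, `h_u` the explicit `conjMap`; in the clock the integral is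
`(1/8) log(y*²/(y*²−4u))`). [cite: Lawler2005, §4.6.1 and §6.3 (Möbius image of a Loewner chain)] -/
theorem stub_steeringArc :
    ∀ (A : Set ℂ), IsStarHull A → ∀ (z₀ : ℂ), z₀ ∈ A → 0 < z₀.im → z₀.re ≠ 0 → ∀ (q : ℝ),
      ∃ (U : ℝ≥0 → ℝ) (S : ℝ≥0) (a : ℂ), Continuous U ∧ U 0 = 0 ∧ a ∈ A ∧ 0 < a.im ∧
        (∀ z ∈ A, (S : WithTop ℝ≥0) < Loewner.swallowingTime U z) ∧
        ENNReal.ofReal q ≤ ∫⁻ s in Set.Ioc (0 : ℝ) S,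
          ENNReal.ofReal (((Loewner.map U s.toNNReal a - U s.toNNReal).im /
            Complex.normSq (Loewner.map U s.toNNReal a - U s.toNNReal)) ^ 2 / 2) :=
  _root_.Summit.CriticalPhenomena.SAWScalingLimit.Theorems.SubseqIdentification.BoundaryAreaLaw.stub_steeringArc

/-- **L3b — TUBE ROBUSTNESS (deterministic, L).** Exact steering data are stable under a sup-norm perturbation of the driver:
if `A ∈ 𝒬*` is alive at `S` under the continuous `U`, `a ∈ A ∩ ℍ`, and the certified integrand of `a` integrates to `≥ 4q` on
`(0, S]`, then for some `η > 0` EVERY continuous `W` with `|W − U| ≤ η` on `[0, S]` keeps all of `A` alive at `S` and has compensator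
`∫_{(0,S]} m(A_s − W_s) ds ≥ q` (Kemppainen–Smirnov Lemma 5.4 `Loewner.exists_forall_dist_map_le_of_driving_close` on the compact `A`
with `ε = (min_{[0,S]} Im Z)/16`; then `Im Z^W ≥ (7/8) Im Z`, `|Z^W| ≤ (9/8)|Z|`, and `m(A_s − W_s) ≥ (Im Z^W/|Z^W|²)²/2`
by `starBubbleMass_ge_of_mem` for the `*`-hull `Loewner.slidHull W A s` (`LoewnerSlidHullStar`) containing `Z^W_s = g^W_s(a) − W_s`).
[cite: KemppainenSmirnov2017, App. A Lemma 5.4] [cite: LawlerSchrammWerner2003Restriction, §5 eq. (5.1)] -/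
theorem stub_compensatorTube :
    ∀ (A : Set ℂ), IsStarHull A → ∀ (U : ℝ≥0 → ℝ) (S : ℝ≥0) (a : ℂ) (q : ℝ),
      Continuous U → a ∈ A → 0 < a.im →
      (∀ z ∈ A, (S : WithTop ℝ≥0) < Loewner.swallowingTime U z) →
      ENNReal.ofReal (4 * q) ≤ ∫⁻ s in Set.Ioc (0 : ℝ) S,
          ENNReal.ofReal (((Loewner.map U s.toNNReal a - U s.toNNReal).im /
            Complex.normSq (Loewner.map U s.toNNReal a - U s.toNNReal)) ^ 2 / 2) →
      ∃ η : ℝ, 0 < η ∧ ∀ (W : ℝ≥0 → ℝ), Continuous W → (∀ s : ℝ≥0, s ≤ S → |W s - U s| ≤ η) →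
        (∀ z ∈ A, (S : WithTop ℝ≥0) < Loewner.swallowingTime W z) ∧
        ENNReal.ofReal q ≤ ∫⁻ s in Set.Ioc (0 : ℝ) S,
          ENNReal.ofReal (starBubbleMass (Loewner.slidHull W A s.toNNReal)) :=
  _root_.Summit.CriticalPhenomena.SAWScalingLimit.Theorems.SubseqIdentification.BoundaryAreaLaw.stub_compensatorTube

/-- **L3c — FROM THE TUBE TO ESSENTIAL UNBOUNDEDNESS (probabilistic glue, L/XL; the lead's stub).** If every nonempty `A ∈ 𝒬*`
admits, for every level `q`, a continuous centre `U` from `0`, a horizon `S` and a width `η > 0` such that every continuous driver in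
the sup-norm `η`-tube about `U` on `[0, S]` keeps `A` alive at `S` with compensator `≥ q` on `(0, S]`, then L3 holds: the SLE_κ driver
lies in the tube with positive probability (`measure_forall_abs_sleDriving_sub_lt_pos`, p154929); given that, the increments after `S`
are an independent Brownian motion (weak Markov property, Mathlib `IsPreBrownianReal.indepFun_shift`), the slid hull `A_S − W_S` is a
`*`-hull which the future SLE avoids forever with probability `≥ Φ'(0)^{α_κ} > 0` (`thm65_printed`, `𝒫 ≤ 1`), the swallowing times
compose (`Loewner` point cocycle), `{γ ∩ A = ∅} = {A alive at all times}` a.s. (`ae_disjoint_closedHull_iff_lt_firstHit`), and on this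
event `λ_κ L^A ≥ λ_κ q > log(1/ε)` for `q` large, i.e. `X_A = e^{−λ_κ L^A} < ε`. [cite: LawlerSchrammWerner2003Restriction, Thm. 6.5]
[cite: Lawler2005, §6.2 (Markov property of SLE)] -/
theorem stub_compensatorEssUnbounded_of_tube :
    (∀ (A : Set ℂ), IsStarHull A → A.Nonempty → ∀ q : ℝ,
      ∃ (U : ℝ≥0 → ℝ) (S : ℝ≥0) (η : ℝ), Continuous U ∧ U 0 = 0 ∧ 0 < η ∧
        ∀ (W : ℝ≥0 → ℝ), Continuous W → (∀ s : ℝ≥0, s ≤ S → |W s - U s| ≤ η) →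
          (∀ z ∈ A, (S : WithTop ℝ≥0) < Loewner.swallowingTime W z) ∧
          ENNReal.ofReal q ≤ ∫⁻ s in Set.Ioc (0 : ℝ) S,
            ENNReal.ofReal (starBubbleMass (Loewner.slidHull W A s.toNNReal))) →
    ∀ (κ : ℝ≥0), 0 < κ → κ < 8 / 3 → ∀ (A : Set ℂ), IsStarHull A → A.Nonempty →
      ∀ (ε : ℝ), 0 < ε →
        0 < preWienerMeasure {ω | Disjoint (range (sleTrace κ ω)) A ∧
            poissonAvoidance (sleBubbleIntensity κ *
              ∫⁻ t, ENNReal.ofReal (starBubbleMass (Loewner.slidHull (sleDriving κ ω) A t)) ∂timeMeasure) <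
              ENNReal.ofReal ε} :=
  _root_.Summit.CriticalPhenomena.SAWScalingLimit.Theorems.SubseqIdentification.BoundaryAreaLaw.stub_compensatorEssUnbounded_of_tube

/-- A nonempty `*`-hull has a point in the open upper half-plane (`A = closure (A ∩ ℍ)`). -/
theorem exists_mem_im_pos_c5 {A : Set ℂ} (hA : IsStarHull A) (hne : A.Nonempty) :
    ∃ z ∈ A, 0 < z.im := by
  by_contra h
  push Not at h
  have hempty : A ∩ upperHalfPlaneSet = ∅ := by
    ext z
    simp only [mem_inter_iff, mem_empty_iff_false, iff_false, not_and]
    intro hz hzH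
    exact absurd hzH (not_lt.2 (h z hz))
  have := hA.isBoundedHull.closure_inter_eq
  rw [hempty, closure_empty] at this
  exact hne.ne_empty this.symm

/-- **The lowest point of a `*`-hull on the imaginary axis** (compactness; `0 ∉ A`): if `i y₁ ∈ A` for some `y₁ > 0` then there is
`y₀ ∈ (0, y₁]` with `i y₀ ∈ A` and `i y ∉ A` for `0 < y < y₀`. -/
theorem exists_lowest_axis_point_c5 {A : Set ℂ} (hA : IsStarHull A) {y₁ : ℝ} (hy₁ : 0 < y₁)
    (hmem : Complex.I * y₁ ∈ A) :
    ∃ y₀ : ℝ, 0 < y₀ ∧ Complex.I * y₀ ∈ A ∧ ∀ y : ℝ, 0 < y → y < y₀ → Complex.I * y ∉ A := by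
  set T : Set ℝ := {y ∈ Icc 0 y₁ | Complex.I * y ∈ A} with hT
  have hcont : Continuous fun y : ℝ => Complex.I * (y : ℂ) := continuous_const.mul Complex.continuous_ofReal
  have hTclosed : IsClosed T := (isClosed_Icc.inter (hA.isBoundedHull.isClosed.preimage hcont))
  have hTcomp : IsCompact T := isCompact_Icc.of_isClosed_subset hTclosed (fun y hy => hy.1)
  have hTne : T.Nonempty := ⟨y₁, ⟨le_of_lt hy₁, le_rfl⟩, hmem⟩
  obtain ⟨y₀, hy₀T, hy₀min⟩ := hTcomp.exists_isMinOn hTne continuous_id.continuousOn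
  refine ⟨y₀, ?_, hy₀T.2, fun y hy hyy h => ?_⟩
  · rcases hy₀T.1.1.eq_or_lt with h0 | h0
    · exfalso
      have : (0 : ℂ) ∈ A := by simpa [← h0] using hy₀T.2
      exact hA.zero_notMem this
    · exact h0
  · have hyT : y ∈ T := ⟨⟨hy.le, (hyy.le.trans hy₀T.1.2)⟩, h⟩
    have := hy₀min hyT
    simp only [id_eq] at this
    exact absurd hyy (not_lt.2 this)

/-- **L3a — STEERING DATA FOR EVERY NONEMPTY `*`-HULL** (glue of the two cases, sorry-free): a point of `A ∩ ℍ` exists; if one lies off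
the imaginary axis use the arc, otherwise the lowest axis point and the vertical ray (zero driver). -/
theorem compensatorSteering_of_cases
    (hV : ∀ (A : Set ℂ), IsStarHull A → ∀ (y₀ : ℝ), 0 < y₀ → Complex.I * y₀ ∈ A →
      (∀ y : ℝ, 0 < y → y < y₀ → Complex.I * y ∉ A) → ∀ (q : ℝ),
      ∃ S : ℝ≥0, (∀ z ∈ A, (S : WithTop ℝ≥0) < Loewner.swallowingTime (fun _ : ℝ≥0 => (0 : ℝ)) z) ∧
        ENNReal.ofReal q ≤ ∫⁻ s in Set.Ioc (0 : ℝ) S,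
          ENNReal.ofReal (((Loewner.map (fun _ : ℝ≥0 => (0 : ℝ)) s.toNNReal (Complex.I * y₀)).im /
            Complex.normSq (Loewner.map (fun _ : ℝ≥0 => (0 : ℝ)) s.toNNReal (Complex.I * y₀))) ^ 2 / 2))
    (hArc : ∀ (A : Set ℂ), IsStarHull A → ∀ (z₀ : ℂ), z₀ ∈ A → 0 < z₀.im → z₀.re ≠ 0 → ∀ (q : ℝ),
      ∃ (U : ℝ≥0 → ℝ) (S : ℝ≥0) (a : ℂ), Continuous U ∧ U 0 = 0 ∧ a ∈ A ∧ 0 < a.im ∧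
        (∀ z ∈ A, (S : WithTop ℝ≥0) < Loewner.swallowingTime U z) ∧
        ENNReal.ofReal q ≤ ∫⁻ s in Set.Ioc (0 : ℝ) S,
          ENNReal.ofReal (((Loewner.map U s.toNNReal a - U s.toNNReal).im /
            Complex.normSq (Loewner.map U s.toNNReal a - U s.toNNReal)) ^ 2 / 2)) :
    ∀ (A : Set ℂ), IsStarHull A → A.Nonempty → ∀ (q : ℝ),
      ∃ (U : ℝ≥0 → ℝ) (S : ℝ≥0) (a : ℂ), Continuous U ∧ U 0 = 0 ∧ a ∈ A ∧ 0 < a.im ∧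
        (∀ z ∈ A, (S : WithTop ℝ≥0) < Loewner.swallowingTime U z) ∧
        ENNReal.ofReal q ≤ ∫⁻ s in Set.Ioc (0 : ℝ) S,
          ENNReal.ofReal (((Loewner.map U s.toNNReal a - U s.toNNReal).im /
            Complex.normSq (Loewner.map U s.toNNReal a - U s.toNNReal)) ^ 2 / 2) := by
  intro A hA hne q
  obtain ⟨z, hzA, hzi⟩ := exists_mem_im_pos_c5 hA hne
  by_cases hre : z.re ≠ 0
  · exact hArc A hA z hzA hzi hre q
  · push Not at hre
    have hz : z = Complex.I * (z.im : ℂ) := by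
      apply Complex.ext <;> simp [hre]
    obtain ⟨y₀, hy₀, hy₀A, hlow⟩ := exists_lowest_axis_point_c5 hA hzi (hz ▸ hzA)
    obtain ⟨S, halive, hint⟩ := hV A hA y₀ hy₀ hy₀A hlow q
    refine ⟨fun _ => 0, S, Complex.I * y₀, continuous_const, rfl, hy₀A, by simp [hy₀], halive, ?_⟩
    simpa using hint

/-- **TUBE STATEMENT FOR EVERY NONEMPTY `*`-HULL** from L3a (both cases) and L3b (sorry-free glue). -/
theorem compensatorTubeAll_of_parts
    (hS : ∀ (A : Set ℂ), IsStarHull A → A.Nonempty → ∀ (q : ℝ),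
      ∃ (U : ℝ≥0 → ℝ) (S : ℝ≥0) (a : ℂ), Continuous U ∧ U 0 = 0 ∧ a ∈ A ∧ 0 < a.im ∧
        (∀ z ∈ A, (S : WithTop ℝ≥0) < Loewner.swallowingTime U z) ∧
        ENNReal.ofReal q ≤ ∫⁻ s in Set.Ioc (0 : ℝ) S,
          ENNReal.ofReal (((Loewner.map U s.toNNReal a - U s.toNNReal).im /
            Complex.normSq (Loewner.map U s.toNNReal a - U s.toNNReal)) ^ 2 / 2))
    (hT : ∀ (A : Set ℂ), IsStarHull A → ∀ (U : ℝ≥0 → ℝ) (S : ℝ≥0) (a : ℂ) (q : ℝ),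
      Continuous U → a ∈ A → 0 < a.im →
      (∀ z ∈ A, (S : WithTop ℝ≥0) < Loewner.swallowingTime U z) →
      ENNReal.ofReal (4 * q) ≤ ∫⁻ s in Set.Ioc (0 : ℝ) S,
          ENNReal.ofReal (((Loewner.map U s.toNNReal a - U s.toNNReal).im /
            Complex.normSq (Loewner.map U s.toNNReal a - U s.toNNReal)) ^ 2 / 2) →
      ∃ η : ℝ, 0 < η ∧ ∀ (W : ℝ≥0 → ℝ), Continuous W → (∀ s : ℝ≥0, s ≤ S → |W s - U s| ≤ η) →
        (∀ z ∈ A, (S : WithTop ℝ≥0) < Loewner.swallowingTime W z) ∧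
        ENNReal.ofReal q ≤ ∫⁻ s in Set.Ioc (0 : ℝ) S,
          ENNReal.ofReal (starBubbleMass (Loewner.slidHull W A s.toNNReal))) :
    ∀ (A : Set ℂ), IsStarHull A → A.Nonempty → ∀ q : ℝ,
      ∃ (U : ℝ≥0 → ℝ) (S : ℝ≥0) (η : ℝ), Continuous U ∧ U 0 = 0 ∧ 0 < η ∧
        ∀ (W : ℝ≥0 → ℝ), Continuous W → (∀ s : ℝ≥0, s ≤ S → |W s - U s| ≤ η) →
          (∀ z ∈ A, (S : WithTop ℝ≥0) < Loewner.swallowingTime W z) ∧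
          ENNReal.ofReal q ≤ ∫⁻ s in Set.Ioc (0 : ℝ) S,
            ENNReal.ofReal (starBubbleMass (Loewner.slidHull W A s.toNNReal)) := by
  intro A hA hne q
  obtain ⟨U, S, a, hU, hU0, haA, hai, halive, hint⟩ := hS A hA hne (4 * q)
  obtain ⟨η, hη, hgood⟩ := hT A hA U S a q hU haA hai halive hint
  exact ⟨U, S, η, hU, hU0, hη, hgood⟩

/-- **L3 — ESSENTIAL UNBOUNDEDNESS OF THE COMPENSATOR ON THE AVOIDANCE EVENT**, now GLUE over L3a-V, L3a-A, L3b, L3c (reshape of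
lead c5; c4's statement kept verbatim — it is consumed by `stub_sleRestrictionRigidityBelow`). For `0 < κ < 8/3`, a nonempty
`A ∈ 𝒬*` and every `ε > 0`: `P[γ ∩ A = ∅, X_A < ε] > 0`. [folklore; implicit in LSW04 §2.1 p. 7 and Lawler 2005 Prop. 6.x] -/
theorem stub_compensatorEssUnbounded :
    ∀ (κ : ℝ≥0), 0 < κ → κ < 8 / 3 → ∀ (A : Set ℂ), IsStarHull A → A.Nonempty →
      ∀ (ε : ℝ), 0 < ε →
        0 < preWienerMeasure {ω | Disjoint (range (sleTrace κ ω)) A ∧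
            poissonAvoidance (sleBubbleIntensity κ *
              ∫⁻ t, ENNReal.ofReal (starBubbleMass (Loewner.slidHull (sleDriving κ ω) A t)) ∂timeMeasure) <
              ENNReal.ofReal ε} :=
  -- LANDED p160397 (the same glue, in the tree):
  _root_.Summit.CriticalPhenomena.SAWScalingLimit.Theorems.SubseqIdentification.BoundaryAreaLaw.stub_compensatorEssUnbounded

/-- The in-workfile glue closes L3 from the four landed stubs exactly as the landed p160397 does. -/
theorem stub_compensatorEssUnbounded_glue :
    ∀ (κ : ℝ≥0), 0 < κ → κ < 8 / 3 → ∀ (A : Set ℂ), IsStarHull A → A.Nonempty →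
      ∀ (ε : ℝ), 0 < ε →
        0 < preWienerMeasure {ω | Disjoint (range (sleTrace κ ω)) A ∧
            poissonAvoidance (sleBubbleIntensity κ *
              ∫⁻ t, ENNReal.ofReal (starBubbleMass (Loewner.slidHull (sleDriving κ ω) A t)) ∂timeMeasure) <
              ENNReal.ofReal ε} :=
  stub_compensatorEssUnbounded_of_tube
    (compensatorTubeAll_of_parts (compensatorSteering_of_cases stub_steeringVertical stub_steeringArc)
      stub_compensatorTube)

/-- **RS5 from its parts (glue, sorry-free): RS5a (hull form) + RS5b (tilted Thm. 6.5) + RS5c (non-degeneracy) + the tree's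
Thm. 6.5 (`thm65_printed`) ⇒ restriction rigidity below 8/3.** With `A, Φ_A` from RS5a and `d = Φ_A'(0)`
(`IsStarHull.exists_hasRestrictionDeriv_holds`): for every `B`, RS5b and RS5a give `E[X_A; E_A ∩ F_B]·P(E_A) = d^α P(E_B) P(E_A)
= d^α P(E_A ∩ F_B) = E[X_A; E_A]·P(E_A ∩ F_B)`, contradicting RS5c. -/
theorem sleRestrictionRigidityBelow_of_parts
    (hM : ∀ (κ : ℝ≥0), 0 < κ → κ ≤ 4 →
      ∀ (D D' : DobrushinDomain) (μ μ' : Measure (CurveClass ℂ)) (x₀ : ℂ) (ρ₀ r : ℝ),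
        0 < r → r < ρ₀ →
        D.carrier ∩ Metric.ball x₀ ρ₀ = {z : ℂ | x₀.im < z.im} ∩ Metric.ball x₀ ρ₀ →
        ρ₀ ≤ dist x₀ (D.pt 0) → ρ₀ ≤ dist x₀ (D.pt 1) →
        D'.carrier = D.carrier \ Metric.closedBall x₀ r → D'.pt 0 = D.pt 0 → D'.pt 1 = D.pt 1 →
        IsSLELaw κ D μ → IsSLELaw κ D' μ' →
        (∀ T : Set (CurveClass ℂ), MeasurableSet T →
            μ' T * μ {c | r ≤ Metric.infDist x₀ c.range} = μ (T ∩ {c | r ≤ Metric.infDist x₀ c.range})) →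
        ∃ (A : Set ℂ) (Φ : ConformalEquiv (upperHalfPlaneSet \ A) upperHalfPlaneSet),
          IsStarHull A ∧ A.Nonempty ∧ IsRestrictionMap A Φ ∧
            ∀ (B : Set ℂ), IsStarHull B →
              preWienerMeasure {ω | Disjoint (range (sleTrace κ ω)) A ∧ ∀ t, 0 < t → Φ (sleTrace κ ω t) ∉ B} =
                preWienerMeasure {ω | Disjoint (range (sleTrace κ ω)) A} *
                  preWienerMeasure {ω | Disjoint (range (sleTrace κ ω)) B})
    (hG : ∀ (κ : ℝ≥0), 0 < κ → κ ≤ 8 / 3 → ∀ (A B : Set ℂ), IsStarHull A → IsStarHull B →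
      ∀ (Φ : ConformalEquiv (upperHalfPlaneSet \ A) upperHalfPlaneSet), IsRestrictionMap A Φ →
        ∀ (d : ℝ), HasRestrictionDeriv A Φ d →
          ∫⁻ ω, {ω | Disjoint (range (sleTrace κ ω)) A ∧ ∀ t, 0 < t → Φ (sleTrace κ ω t) ∉ B}.indicator
              (fun ω => poissonAvoidance (sleBubbleIntensity κ *
                ∫⁻ t, ENNReal.ofReal (starBubbleMass (Loewner.slidHull (sleDriving κ ω) A t)) ∂timeMeasure)) ω
            ∂preWienerMeasure =
          ENNReal.ofReal (d ^ sleBubbleExponent κ) * preWienerMeasure {ω | Disjoint (range (sleTrace κ ω)) B})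
    (hN : ∀ (κ : ℝ≥0), 0 < κ → κ < 8 / 3 → ∀ (A : Set ℂ), IsStarHull A → A.Nonempty →
      ∀ (Φ : ConformalEquiv (upperHalfPlaneSet \ A) upperHalfPlaneSet), IsRestrictionMap A Φ →
        ∃ B : Set ℂ, IsStarHull B ∧
          (∫⁻ ω, {ω | Disjoint (range (sleTrace κ ω)) A ∧ ∀ t, 0 < t → Φ (sleTrace κ ω t) ∉ B}.indicator
              (fun ω => poissonAvoidance (sleBubbleIntensity κ *
                ∫⁻ t, ENNReal.ofReal (starBubbleMass (Loewner.slidHull (sleDriving κ ω) A t)) ∂timeMeasure)) ω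
              ∂preWienerMeasure) *
            preWienerMeasure {ω | Disjoint (range (sleTrace κ ω)) A} ≠
          (∫⁻ ω, {ω | Disjoint (range (sleTrace κ ω)) A}.indicator
              (fun ω => poissonAvoidance (sleBubbleIntensity κ *
                ∫⁻ t, ENNReal.ofReal (starBubbleMass (Loewner.slidHull (sleDriving κ ω) A t)) ∂timeMeasure)) ω
              ∂preWienerMeasure) *
            preWienerMeasure {ω | Disjoint (range (sleTrace κ ω)) A ∧ ∀ t, 0 < t → Φ (sleTrace κ ω t) ∉ B}) :
    ∀ (κ : ℝ≥0), 0 < κ → κ < 8 / 3 →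
      ∀ (D D' : DobrushinDomain) (μ μ' : Measure (CurveClass ℂ)) (x₀ : ℂ) (ρ₀ r : ℝ),
        0 < r → r < ρ₀ →
        D.carrier ∩ Metric.ball x₀ ρ₀ = {z : ℂ | x₀.im < z.im} ∩ Metric.ball x₀ ρ₀ →
        ρ₀ ≤ dist x₀ (D.pt 0) → ρ₀ ≤ dist x₀ (D.pt 1) →
        D'.carrier = D.carrier \ Metric.closedBall x₀ r → D'.pt 0 = D.pt 0 → D'.pt 1 = D.pt 1 →
        IsSLELaw κ D μ → IsSLELaw κ D' μ' →
        ¬ ∀ T : Set (CurveClass ℂ), MeasurableSet T →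
            μ' T * μ {c | r ≤ Metric.infDist x₀ c.range} =
              μ (T ∩ {c | r ≤ Metric.infDist x₀ c.range}) := by
  intro κ hκ hκ83 D D' μ μ' x₀ ρ₀ r hr hrρ hwin ha hb hcar h0 h1 hμ hμ' hid
  have h83 : (8 / 3 : ℝ≥0) ≤ 4 := by
    rw [div_le_iff₀ (by norm_num : (0 : ℝ≥0) < 3)]
    norm_num
  obtain ⟨A, Φ, hA, hne, hΦ, hprod⟩ :=
    hM κ hκ (hκ83.le.trans h83) D D' μ μ' x₀ ρ₀ r hr hrρ hwin ha hb hcar h0 h1 hμ hμ' hid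
  obtain ⟨d, -, -, hd⟩ := IsStarHull.exists_hasRestrictionDeriv_holds hA hΦ
  obtain ⟨B, hB, hneq⟩ := hN κ hκ hκ83 A hA hne Φ hΦ
  apply hneq
  have hempty : preWienerMeasure {ω | Disjoint (range (sleTrace κ ω)) (∅ : Set ℂ)} = 1 := by
    haveI := isProbabilityMeasure_preWienerMeasure'
    simp
  have hG0 := hG κ hκ hκ83.le A ∅ hA isStarHull_empty Φ hΦ d hd
  have hset : {ω : ℝ≥0 → ℝ | Disjoint (range (sleTrace κ ω)) A ∧ ∀ t, 0 < t → Φ (sleTrace κ ω t) ∉ (∅ : Set ℂ)} =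
      {ω | Disjoint (range (sleTrace κ ω)) A} := by
    ext ω
    simp
  rw [hset, hempty, mul_one] at hG0
  rw [hG κ hκ hκ83.le A B hA hB Φ hΦ d hd, hG0, hprod B hB]
  ring

/-- **RS5 below 8/3, DERIVED r-c4-8 from the law-level parts L1 (p152723), L2′ (p153880), L3 (residual) by the landed glue
`stub_sleRestrictionRigidityBelow_of_lawPartsAvoid` (p154031; r-c4-7 glue p151364; the r-c4-3 glue `sleRestrictionRigidityBelow_of_parts` from RS5a/RS5b/RS5c above is kept for the record, RS5a `stub_sleAvoidProductOfIdentity`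
and RS5b `stub_thm65Tilted` are PROVED). -/
theorem stub_sleRestrictionRigidityBelow :
    ∀ (κ : ℝ≥0), 0 < κ → κ < 8 / 3 →
      ∀ (D D' : DobrushinDomain) (μ μ' : Measure (CurveClass ℂ)) (x₀ : ℂ) (ρ₀ r : ℝ),
        0 < r → r < ρ₀ →
        D.carrier ∩ Metric.ball x₀ ρ₀ = {z : ℂ | x₀.im < z.im} ∩ Metric.ball x₀ ρ₀ →
        ρ₀ ≤ dist x₀ (D.pt 0) → ρ₀ ≤ dist x₀ (D.pt 1) →
        D'.carrier = D.carrier \ Metric.closedBall x₀ r → D'.pt 0 = D.pt 0 → D'.pt 1 = D.pt 1 →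
        IsSLELaw κ D μ → IsSLELaw κ D' μ' →
        ¬ ∀ T : Set (CurveClass ℂ), MeasurableSet T →
            μ' T * μ {c | r ≤ Metric.infDist x₀ c.range} =
              μ (T ∩ {c | r ≤ Metric.infDist x₀ c.range}) :=
  -- LANDED p160681 (= `…of_lawPartsAvoid stub_tiltedLawIdentity compensatorFactorsThroughCurve_of_disjoint stub_compensatorEssUnbounded`):
  _root_.Summit.CriticalPhenomena.SAWScalingLimit.Theorems.SubseqIdentification.BoundaryAreaLaw.stub_sleRestrictionRigidityBelow

/-- **Composition of the restriction reshape `S1 → S2 → T′ → S4⁺ → S5⁺ → S6⁺ → RS2a → RS2b → RS3 → RS5 → SubseqIdentification`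
(kernel-checked, no `sorry`).** Given the crux hypotheses for `(D; a, b)`, `s`, `μ`: take the reference window `(D₀; a₀, b₀)`,
`x₀`, `ρ₀` (S2) and shrink the radius below the distances to the marked points; extract a subsequential limit `ν₀` in `D₀`
along `s ∘ φ₀` (T′); pick a radius `r ∈ (0, ρ₁/4]` that is not an atom of `dist(x₀, trace)` under `ν₀`
(`exists_radius_level_null`); carve `D₁ = D₀ ∖ B̄(x₀, r)` (RS2a), transfer the endpoint approximation and the lattice
nesting (RS2b), and extract a further subsequential limit `ν₁` in `D₁` along `s ∘ φ₀ ∘ φ₁` (T′). The dock (S1) along the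
final subsequence gives ONE `κ` with `μ = SLE_κ(D)`, `ν₀ = SLE_κ(D₀)`, `ν₁ = SLE_κ(D₁)`; S4⁺ → S5⁺ → S6⁺ give `κ ≤ 8/3`; RS3
gives the restriction identity between `ν₁` and `ν₀` at radius `r`; if `κ ≠ 8/3`, RS5 (with `κ < 8/3`) refutes that
identity — so `κ = 8/3` and `μ = SLE_{8/3}(D)`, the crux BY NAME. -/
theorem SubseqIdentification_of_restriction
    (h₁ : ∀ (s : ℕ → ℝ), Tendsto s atTop (𝓝[>] (0 : ℝ)) →
      ∃ κ : ℝ≥0, 0 < κ ∧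
        ∀ (D : DobrushinDomain) (a b : ℝ → Site 2), SAW.IsEndpointApprox D a b →
          ∀ (μ : Measure (CurveClass ℂ)), IsProbabilityMeasure μ →
            (∀ f : CurveClass ℂ →ᵇ ℝ,
              Tendsto (fun n => ∫ γ, f γ.curve ∂(SAW.law D.carrier (s n) (a (s n)) (b (s n))))
                atTop (𝓝 (∫ x, f x ∂μ))) →
            IsSLELaw κ D μ)
    (h₂ : ∃ (D₀ : DobrushinDomain) (a₀ b₀ : ℝ → Site 2) (x₀ : ℂ) (ρ₀ : ℝ),
      SAW.IsEndpointApprox D₀ a₀ b₀ ∧ 0 < ρ₀ ∧ x₀ ≠ D₀.pt 0 ∧ x₀ ≠ D₀.pt 1 ∧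
        D₀.carrier ∩ Metric.ball x₀ ρ₀ = {z : ℂ | x₀.im < z.im} ∩ Metric.ball x₀ ρ₀)
    (h₃ : ∀ (D : DobrushinDomain) (a b : ℝ → Site 2), SAW.IsEndpointApprox D a b →
      ∀ (s : ℕ → ℝ), Tendsto s atTop (𝓝[>] (0 : ℝ)) →
        ∃ φ : ℕ → ℕ, StrictMono φ ∧ ∃ μ : Measure (CurveClass ℂ), IsProbabilityMeasure μ ∧
          ∀ f : CurveClass ℂ →ᵇ ℝ,
            Tendsto (fun n => ∫ γ, f γ.curve
                ∂(SAW.law D.carrier (s (φ n)) (a (s (φ n))) (b (s (φ n)))))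
              atTop (𝓝 (∫ x, f x ∂μ)))
    (h₄ : ∀ (D : DobrushinDomain) (a b : ℝ → Site 2), SAW.IsEndpointApprox D a b →
      ∀ (x₀ : ℂ) (ρ₀ : ℝ), 0 < ρ₀ →
        D.carrier ∩ Metric.ball x₀ ρ₀ = {z : ℂ | x₀.im < z.im} ∩ Metric.ball x₀ ρ₀ →
        x₀ ≠ D.pt 0 → x₀ ≠ D.pt 1 →
        ∃ C ε₀ : ℝ, 0 < C ∧ 0 < ε₀ ∧ ∀ r : ℝ, 0 < r → r ≤ ε₀ →
          ∀ᶠ δ in 𝓝[>] (0 : ℝ),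
            SAW.law D.carrier δ (a δ) (b δ) {γ | Metric.infDist x₀ γ.curve.range ≤ r} *
                ENNReal.ofReal (ε₀ ^ 2) ≤
              ENNReal.ofReal C *
                SAW.law D.carrier δ (a δ) (b δ) {γ | Metric.infDist x₀ γ.curve.range ≤ ε₀} *
                  ENNReal.ofReal (r ^ 2))
    (h₅ : ∀ (D : DobrushinDomain) (a b : ℝ → Site 2) (s : ℕ → ℝ) (μ : Measure (CurveClass ℂ)) (x₀ : ℂ),
      Tendsto s atTop (𝓝[>] (0 : ℝ)) → IsProbabilityMeasure μ →
      (∀ f : CurveClass ℂ →ᵇ ℝ,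
        Tendsto (fun n => ∫ γ, f γ.curve ∂(SAW.law D.carrier (s n) (a (s n)) (b (s n))))
          atTop (𝓝 (∫ x, f x ∂μ))) →
      (∃ C ε₀ : ℝ, 0 < C ∧ 0 < ε₀ ∧ ∀ r : ℝ, 0 < r → r ≤ ε₀ → ∀ᶠ n in atTop,
          SAW.law D.carrier (s n) (a (s n)) (b (s n)) {γ | Metric.infDist x₀ γ.curve.range ≤ r} *
                ENNReal.ofReal (ε₀ ^ 2) ≤
              ENNReal.ofReal C *
                SAW.law D.carrier (s n) (a (s n)) (b (s n))
                    {γ | Metric.infDist x₀ γ.curve.range ≤ ε₀} *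
                  ENNReal.ofReal (r ^ 2)) →
      ∃ C r₀ : ℝ, 0 < r₀ ∧ ∀ r ∈ Set.Ioo (0 : ℝ) r₀,
        μ {γ | Metric.infDist x₀ γ.range < r} ≤ ENNReal.ofReal (C * r ^ 2))
    (h₆ : ∀ (κ : ℝ≥0) (D : DobrushinDomain) (μ : Measure (CurveClass ℂ)) (x₀ : ℂ) (ρ₀ : ℝ),
      0 < κ → IsSLELaw κ D μ → 0 < ρ₀ →
      D.carrier ∩ Metric.ball x₀ ρ₀ = {z : ℂ | x₀.im < z.im} ∩ Metric.ball x₀ ρ₀ →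
      x₀ ≠ D.pt 0 → x₀ ≠ D.pt 1 →
      (∃ C r₀ : ℝ, 0 < r₀ ∧ ∀ r ∈ Set.Ioo (0 : ℝ) r₀,
          μ {γ | Metric.infDist x₀ γ.range < r} ≤ ENNReal.ofReal (C * r ^ 2)) →
      κ ≤ 8 / 3)
    (h₇ : ∀ (D : DobrushinDomain) (x₀ : ℂ) (ρ₀ r : ℝ), 0 < r → r < ρ₀ →
      D.carrier ∩ Metric.ball x₀ ρ₀ = {z : ℂ | x₀.im < z.im} ∩ Metric.ball x₀ ρ₀ →
      ρ₀ ≤ dist x₀ (D.pt 0) → ρ₀ ≤ dist x₀ (D.pt 1) →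
      ∃ D' : DobrushinDomain,
        D'.carrier = D.carrier \ Metric.closedBall x₀ r ∧ D'.pt 0 = D.pt 0 ∧ D'.pt 1 = D.pt 1)
    (h₈ : ∀ (D D' : DobrushinDomain) (a b : ℝ → Site 2) (x₀ : ℂ) (ρ₀ r : ℝ),
      SAW.IsEndpointApprox D a b → 0 < r → 4 * r ≤ ρ₀ →
      D.carrier ∩ Metric.ball x₀ ρ₀ = {z : ℂ | x₀.im < z.im} ∩ Metric.ball x₀ ρ₀ →
      ρ₀ ≤ dist x₀ (D.pt 0) → ρ₀ ≤ dist x₀ (D.pt 1) →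
      D'.carrier = D.carrier \ Metric.closedBall x₀ r → D'.pt 0 = D.pt 0 → D'.pt 1 = D.pt 1 →
      SAW.IsEndpointApprox D' a b ∧
        ∀ᶠ δ in 𝓝[>] (0 : ℝ),
          (∀ γ' : SAW.DomainSAW D'.carrier δ (a δ) (b δ),
              ∃ γ : SAW.DomainSAW D.carrier δ (a δ) (b δ), γ.walk.support = γ'.walk.support) ∧
          (∀ γ : SAW.DomainSAW D.carrier δ (a δ) (b δ), r < Metric.infDist x₀ γ.curve.range →
              ∃ γ' : SAW.DomainSAW D'.carrier δ (a δ) (b δ), γ'.walk.support = γ.walk.support) ∧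
          (∀ γ : SAW.DomainSAW D.carrier δ (a δ) (b δ),
              (∃ γ' : SAW.DomainSAW D'.carrier δ (a δ) (b δ), γ'.walk.support = γ.walk.support) →
              r ≤ Metric.infDist x₀ γ.curve.range))
    (h₉ : ∀ (Ω Ω' : Set ℂ) (a b : ℝ → Site 2) (s : ℕ → ℝ) (μ μ' : Measure (CurveClass ℂ)) (x₀ : ℂ) (r : ℝ),
      Tendsto s atTop (𝓝[>] (0 : ℝ)) → IsProbabilityMeasure μ → IsProbabilityMeasure μ' →
      (∀ f : CurveClass ℂ →ᵇ ℝ,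
        Tendsto (fun n => ∫ γ, f γ.curve ∂(SAW.law Ω (s n) (a (s n)) (b (s n))))
          atTop (𝓝 (∫ x, f x ∂μ))) →
      (∀ f : CurveClass ℂ →ᵇ ℝ,
        Tendsto (fun n => ∫ γ, f γ.curve ∂(SAW.law Ω' (s n) (a (s n)) (b (s n))))
          atTop (𝓝 (∫ x, f x ∂μ'))) →
      (∀ᶠ n in atTop,
          (∀ γ' : SAW.DomainSAW Ω' (s n) (a (s n)) (b (s n)),
              ∃ γ : SAW.DomainSAW Ω (s n) (a (s n)) (b (s n)), γ.walk.support = γ'.walk.support) ∧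
          (∀ γ : SAW.DomainSAW Ω (s n) (a (s n)) (b (s n)), r < Metric.infDist x₀ γ.curve.range →
              ∃ γ' : SAW.DomainSAW Ω' (s n) (a (s n)) (b (s n)), γ'.walk.support = γ.walk.support) ∧
          (∀ γ : SAW.DomainSAW Ω (s n) (a (s n)) (b (s n)),
              (∃ γ' : SAW.DomainSAW Ω' (s n) (a (s n)) (b (s n)), γ'.walk.support = γ.walk.support) →
              r ≤ Metric.infDist x₀ γ.curve.range)) →
      μ {c | Metric.infDist x₀ c.range = r} = 0 →
      ∀ T : Set (CurveClass ℂ), MeasurableSet T →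
        μ' T * μ {c | r ≤ Metric.infDist x₀ c.range} = μ (T ∩ {c | r ≤ Metric.infDist x₀ c.range}))
    (h₁₀ : ∀ (κ : ℝ≥0), 0 < κ → κ < 8 / 3 →
      ∀ (D D' : DobrushinDomain) (μ μ' : Measure (CurveClass ℂ)) (x₀ : ℂ) (ρ₀ r : ℝ),
        0 < r → r < ρ₀ →
        D.carrier ∩ Metric.ball x₀ ρ₀ = {z : ℂ | x₀.im < z.im} ∩ Metric.ball x₀ ρ₀ →
        ρ₀ ≤ dist x₀ (D.pt 0) → ρ₀ ≤ dist x₀ (D.pt 1) →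
        D'.carrier = D.carrier \ Metric.closedBall x₀ r → D'.pt 0 = D.pt 0 → D'.pt 1 = D.pt 1 →
        IsSLELaw κ D μ → IsSLELaw κ D' μ' →
        ¬ ∀ T : Set (CurveClass ℂ), MeasurableSet T →
            μ' T * μ {c | r ≤ Metric.infDist x₀ c.range} =
              μ (T ∩ {c | r ≤ Metric.infDist x₀ c.range})) :
    SubseqIdentification := by
  intro D a b hab s μ hs hμ hlim
  -- S2: the reference window; shrink its radius below the distances to the marked points
  obtain ⟨D₀, a₀, b₀, x₀, ρ₀, hab₀, hρ₀, hx0, hx1, hwin⟩ := h₂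
  set ρ₁ : ℝ := min ρ₀ (min (dist x₀ (D₀.pt 0)) (dist x₀ (D₀.pt 1))) with hρ₁def
  have hρ₁ : 0 < ρ₁ := lt_min hρ₀ (lt_min (dist_pos.2 hx0) (dist_pos.2 hx1))
  have hρ₁ρ₀ : ρ₁ ≤ ρ₀ := min_le_left _ _
  have hρ₁a : ρ₁ ≤ dist x₀ (D₀.pt 0) := (min_le_right _ _).trans (min_le_left _ _)
  have hρ₁b : ρ₁ ≤ dist x₀ (D₀.pt 1) := (min_le_right _ _).trans (min_le_right _ _)
  have hwin₁ : D₀.carrier ∩ Metric.ball x₀ ρ₁ = {z : ℂ | x₀.im < z.im} ∩ Metric.ball x₀ ρ₁ :=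
    window_mono_c4 hwin hρ₁ρ₀
  -- T′: a subsequential limit `ν₀` in the reference domain along `s ∘ φ₀`
  obtain ⟨φ₀, hφ₀, ν₀, hν₀, hlim₀⟩ := h₃ D₀ a₀ b₀ hab₀ s hs
  have hs₀ : Tendsto (s ∘ φ₀) atTop (𝓝[>] (0 : ℝ)) := hs.comp hφ₀.tendsto_atTop
  -- a good radius
  haveI := hν₀
  obtain ⟨r, hr0, hr4, hatom⟩ := exists_radius_level_null ν₀ x₀ hρ₁
  have hrρ₁ : r < ρ₁ := by linarith
  -- RS2a/RS2b: the carved sub-domain, its endpoint approximation and lattice nesting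
  obtain ⟨D₁, hcar, hpt0, hpt1⟩ := h₇ D₀ x₀ ρ₁ r hr0 hrρ₁ hwin₁ hρ₁a hρ₁b
  obtain ⟨hab₁, hnest⟩ := h₈ D₀ D₁ a₀ b₀ x₀ ρ₁ r hab₀ hr0 hr4 hwin₁ hρ₁a hρ₁b hcar hpt0 hpt1
  -- T′ again: a subsequential limit `ν₁` in the carved domain along `s ∘ φ₀ ∘ φ₁`
  obtain ⟨φ₁, hφ₁, ν₁, hν₁, hlim₁⟩ := h₃ D₁ a₀ b₀ hab₁ (s ∘ φ₀) hs₀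
  have hs₁ : Tendsto (s ∘ φ₀ ∘ φ₁) atTop (𝓝[>] (0 : ℝ)) := hs₀.comp hφ₁.tendsto_atTop
  have hlim₀' : ∀ f : CurveClass ℂ →ᵇ ℝ,
      Tendsto (fun n => ∫ γ, f γ.curve
          ∂(SAW.law D₀.carrier ((s ∘ φ₀ ∘ φ₁) n) (a₀ ((s ∘ φ₀ ∘ φ₁) n)) (b₀ ((s ∘ φ₀ ∘ φ₁) n))))
        atTop (𝓝 (∫ x, f x ∂ν₀)) :=
    fun f => (hlim₀ f).comp hφ₁.tendsto_atTop
  have hlim₁' : ∀ f : CurveClass ℂ →ᵇ ℝ,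
      Tendsto (fun n => ∫ γ, f γ.curve
          ∂(SAW.law D₁.carrier ((s ∘ φ₀ ∘ φ₁) n) (a₀ ((s ∘ φ₀ ∘ φ₁) n)) (b₀ ((s ∘ φ₀ ∘ φ₁) n))))
        atTop (𝓝 (∫ x, f x ∂ν₁)) := hlim₁
  -- S1: one `κ` along the final subsequence for `D`, `D₀` and `D₁`
  obtain ⟨κ, hκ, hdock⟩ := h₁ (s ∘ φ₀ ∘ φ₁) hs₁
  have hD : IsSLELaw κ D μ :=
    hdock D a b hab μ hμ fun f => ((hlim f).comp hφ₀.tendsto_atTop).comp hφ₁.tendsto_atTop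
  have hD₀ : IsSLELaw κ D₀ ν₀ := hdock D₀ a₀ b₀ hab₀ ν₀ hν₀ hlim₀'
  have hD₁ : IsSLELaw κ D₁ ν₁ := hdock D₁ a₀ b₀ hab₁ ν₁ hν₁ hlim₁'
  -- S4⁺ → S5⁺ → S6⁺: `κ ≤ 8/3`
  obtain ⟨C, ε₀, hC, hε₀, hlaw⟩ := h₄ D₀ a₀ b₀ hab₀ x₀ ρ₀ hρ₀ hwin hx0 hx1
  have hup := h₅ D₀ a₀ b₀ (s ∘ φ₀ ∘ φ₁) ν₀ x₀ hs₁ hν₀ hlim₀'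
    ⟨C, ε₀, hC, hε₀, fun r hr hrε => hs₁.eventually (hlaw r hr hrε)⟩
  have hκle : κ ≤ 8 / 3 := h₆ κ D₀ ν₀ x₀ ρ₀ hκ hD₀ hρ₀ hwin hx0 hx1 hup
  -- RS3: the restriction identity between `ν₁` and `ν₀` at radius `r`
  have hident := h₉ D₀.carrier D₁.carrier a₀ b₀ (s ∘ φ₀ ∘ φ₁) ν₀ ν₁ x₀ r hs₁ hν₀ hν₁ hlim₀' hlim₁'
    (hs₁.eventually hnest) hatom
  -- RS5: rigidity
  rcases eq_or_ne κ (8 / 3) with hk | hk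
  · rw [hk] at hD
    exact hD
  · exact absurd hident (h₁₀ κ hκ (lt_of_le_of_ne hκle hk) D₀ D₁ ν₀ ν₁ x₀ ρ₁ r hr0 hrρ₁ hwin₁
      hρ₁a hρ₁b hcar hpt0 hpt1 hD₀ hD₁)

/-- **`<Crux>_proof` of the restriction reshape**: the composition instantiated with the registered stubs and the route's
registered target T′ (`SAWRenewalTightness.EventualTight`, stmt-CriticalPhenomena-1372, BY NAME). Closes the crux BY NAME as soon as
S1, S4⁺, S5⁺, S6⁺, RS2a, RS2b, RS3, RS5 are proved and T′ has landed. -/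
theorem SubseqIdentification_proof_restriction (hT : EventualTight) : SubseqIdentification :=
  SubseqIdentification_of_restriction stub_identificationUpToKappa stub_referenceWindow
    (subseqLimitsExist_of_eventualTight hT) stub_latticeAreaUpperBound stub_areaUpperOfLimit
    stub_kappaLeOfUpper stub_halfBallSubdomain stub_halfBallNesting stub_restrictionPassage
    stub_sleRestrictionRigidityBelow

/-- The shared decl of the payload route, by the restriction composition, definitionally. -/
theorem SubseqIdentification_renewalTightness_restriction (hT : EventualTight) :
    Summit.CriticalPhenomena.SAWScalingLimit.Theses.SAWRenewalTightness.SubseqIdentification :=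
  SubseqIdentification_proof_restriction hT

/-! ## Sanity anchors of the restriction reshape (sorry-free) -/

/-- **Non-vacuity of the restriction pin: the identity negated in RS5 HOLDS at `κ = 8/3`** (LSW03 Thm. 6.1 transposed;
landed `sleRestrictionConsistency_eightThirds`, p134385) — so RS5 cannot be weakened to include `κ = 8/3`, and the reshape is
consistent with the crux (necessity direction: under `SubseqIdentification` every limit is SLE_{8/3} and the identity holds). -/
theorem sleRestrictionIdentity_eightThirds :
    ∀ (D D' : DobrushinDomain) (μ μ' : Measure (CurveClass ℂ)) (x₀ : ℂ) (ρ₀ r : ℝ),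
      0 < r → r < ρ₀ →
      D.carrier ∩ Metric.ball x₀ ρ₀ = {z : ℂ | x₀.im < z.im} ∩ Metric.ball x₀ ρ₀ →
      ρ₀ ≤ dist x₀ (D.pt 0) → ρ₀ ≤ dist x₀ (D.pt 1) →
      D'.carrier = D.carrier \ Metric.closedBall x₀ r → D'.pt 0 = D.pt 0 → D'.pt 1 = D.pt 1 →
      IsSLELaw (8 / 3) D μ → IsSLELaw (8 / 3) D' μ' →
      ∀ T : Set (CurveClass ℂ), MeasurableSet T →
        μ' T * μ {c | r ≤ Metric.infDist x₀ c.range} =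
          μ (T ∩ {c | r ≤ Metric.infDist x₀ c.range}) :=
  _root_.Summit.CriticalPhenomena.SAWScalingLimit.Theorems.SubseqIdentification.BoundaryAreaLaw.sleRestrictionConsistency_eightThirds

/-- **S4⁺ is necessary**: it follows from the LSW conjecture as typed (through the necessity of S4, lead c3, p130318). -/
theorem latticeAreaUpperBound_of_sawScalingLimit (h : SAW.SAWScalingLimit) :
    ∀ (D : DobrushinDomain) (a b : ℝ → Site 2), SAW.IsEndpointApprox D a b →
      ∀ (x₀ : ℂ) (ρ₀ : ℝ), 0 < ρ₀ →
        D.carrier ∩ Metric.ball x₀ ρ₀ = {z : ℂ | x₀.im < z.im} ∩ Metric.ball x₀ ρ₀ →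
        x₀ ≠ D.pt 0 → x₀ ≠ D.pt 1 →
        ∃ C ε₀ : ℝ, 0 < C ∧ 0 < ε₀ ∧ ∀ r : ℝ, 0 < r → r ≤ ε₀ →
          ∀ᶠ δ in 𝓝[>] (0 : ℝ),
            SAW.law D.carrier δ (a δ) (b δ) {γ | Metric.infDist x₀ γ.curve.range ≤ r} *
                ENNReal.ofReal (ε₀ ^ 2) ≤
              ENNReal.ofReal C *
                SAW.law D.carrier δ (a δ) (b δ) {γ | Metric.infDist x₀ γ.curve.range ≤ ε₀} *
                  ENNReal.ofReal (r ^ 2) :=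
  latticeAreaUpperBound_of_latticeAreaLaw (latticeAreaLaw_of_sawScalingLimit h)

end Summit.CriticalPhenomena.SAWScalingLimit.Cruxes.SubseqIdentification.BoundaryAreaLaw
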